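import Literature.Claims.NS.Iotti2025
import HarnessLib

/-!
# Claim skeleton: U. Iotti (2011), «Global in time solution to the incompressible Navier-Stokes
# equations on ℝⁿ. An Elementary Approach» (arXiv 1107.3403 v2; WITHDRAWN v3)

Cell `ns-claims` (D-0090 NS-CLAIMS SWEEP), claim **C28** (elder row of the family whose 2025 member is
C28b `Iotti2025`, ADJUDICATED #43), typist `ns-claims-typist-10` (g2; lanes per the lead's table; sources
lit-4: `pub/ns-claims/sources/Iotti2011/`, LOCATORS.md, `v2-pages/p0001–p0010.txt`, TeX). UNREFEREED,
WITHDRAWN CLAIM under adjudication — NOTHING in this file asserts a step: every `Step_k` is a `Prop` (a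
printed assertion, typed so that `¬ Step_k` or its vacuity is a kernel statement for
`Theorems/SoloRefuteIotti2011.lean`); the only `theorem`s are the kernel composition of the paper's own
implications, the Clay link, and plumbing.

Version of record: arXiv:1107.3403 **v2** (2011-07-21, 10 pp., math.AP; last full text)
[Iotti2011NSLinfty]; print page = PDF page; displays on a page are counted from the top («p.4 d2» = second
displayed formula of page 4). v3 (2011-09-01) is the author's withdrawal: arXiv Comments field, verbatim,
«They are possible other cases at first done not contemplate. This paper has been withdrawn by the author
due to a crucial sign error in equation 1 page 4». Lineage: arXiv 2503.03991 (2025) = C28b attacks the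
same quantity `‖u(t)‖_∞` by a different device (`Literature.Claims.NS.Iotti2025`, imported for the shared
vocabulary `supNorm`).

## Setting (p. 1, (1.1)–(1.3)) and claimed statements (p. 3, p. 7)

(1.1): `∂ₜu = νΔu − u·∇u − ∇p + f`, `∇·u = 0`, `u(x,0) = u₀(x)` on `ℝⁿ × [0,∞)`, «μ ⩾ 0» (the viscosity is
written `ν` in the equation and `μ` in the parameter line; «For μ = 0, 1.1 is the Euler evolution problem» —
Euler is INCLUDED as printed), `u₀ ∈ C^∞(ℝⁿ)`, `∇·u₀ = 0`, (1.2) `|∂^α u₀(x)| ⩽ C_{αK}(1+|x|)^{−K}` (= Clay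
(4)), (1.3) `|∂^α_x ∂^m_t f(x,t)| ⩽ C_{αmK}(1+|x|+t)^{−K}` (= Clay (5)). Rendered at `n = 3` in the tree's
vocabulary — TODO(general form): every `n ⩾ 2`.

* **Theorem 3.1 (p. 3) (Derivative of the `L^∞` norm)** «Let u be a solution in [0,T*) of the problem 1.1
  described in the theorem 2.2, be t ∈ (0,T*), then (3.1) d‖u(t)‖_∞/dt ⩽ ‖Pf(t)‖_∞» — `Theorem31`.
* **Theorem 3.2 (p. 7) (Extension theorem)** «In the hypotheses of the Theorem 3.1, the solution u can be
  extended to the whole real axis of time.» With Theorem 2.2 (a local solution exists for every admissible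
  datum) this is the abstract's «theorem of global time-extension for the local classical solution» = a
  global classical solution for every `ν ⩾ 0`, every datum (1.2) and every force (1.3) — `ClaimedTheorem`.

## Rendering (TODO(general form): `u ∈ C([0,T*); V^s) ∩ C¹([0,T*); V^{s−2})`, one `s > n/2 + 2`)

«Solution described in Theorem 2.2» = classical solution of the FORCED system in the tree's sense
(`IsClassicalNSSolutionOn (Ico 0 T) ν f u p`: `u`, `p` jointly smooth, (1.1) pointwise) with `u 0 = u₀`
and the two printed memberships rendered in the cell's Beale–Kato–Majda convention (as C17 `Chae2007`,
C28b `Iotti2025`): all `L²` Sobolev norms of `u(t)` AND of `∂ₜu(t)` bounded on compact sub-intervals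
(`IsLocalSolution`, `IsGlobalSolution`). «T* the maximal time» = no solution of the class on a longer
interval agrees with `u` on `[0,T*)` (`ExtendsPast`). The Helmholtz–Leray decomposition of p. 2 («for al
v ∈ L²(ℝⁿ) ∩ C^∞(ℝⁿ) has a unique orthogonal decomposition v = Pv + ∇q, ∇·(Pv) = 0, q = Δ⁻¹∇·v, Pv, ∇q ∈
L²(ℝⁿ) ∩ C^∞(ℝⁿ)») is the predicate `IsHelmholtzPair v w q` (`w` in the role of `Pv`; the pair is unique
by the classical `L²` orthogonality, so no inverse Laplacian is defined here). `‖·‖_∞` is C28b's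
`Iotti2025.supNorm` (pointwise supremum; junk `0` for unbounded fields — fields of the class are bounded);
«x̃ an absolute maximum point for |u(·,t)|» is `IsAbsMax (u t) x̃`; `∇u(x̃,t)` is `fderiv ℝ (u t) x̃`;
`u·∇u` is the tree's `convect (u t) (u t)`; `∂ₜ` is the one-sided `timeDerivWithin (Ico 0 T)`.

## Clay delta (reference `ClayVariants.lean`, Δ-axes §3)

Nearest: (A) `clayR3.Regularity` — the claim is the FORCED statement for every `ν ⩾ 0`, STRONGER than (A)
on three axes: Δ2 «μ ⩾ 0» includes Euler (flag: the `ν = 0` instance is not a Clay statement and its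
continuation criterion `Step_2` is not classical there) · Δ3 forces of class (5) ⊇ {0} · Δ7 every `ν`.
Δ1 `ℝ³` (print: `ℝⁿ`, `n ⩾ 2`) = · Δ4 data (1.2) = (4) token for token · Δ5 classical solutions with all
Sobolev norms bounded on compact time intervals: smoothness on `ℝ³ × [0,∞)` is part of the class and the
energy bound (7) follows at `f ≡ 0` from the tree's energy inequality (`bkm_energy_le`) — `clay_of_claimed :
ClaimedTheorem → clayR3.Regularity` is PROVED (the `ν > 0`, `f ≡ 0` instance; the argument of C28b's
`Iotti2025.clay_of_claimedGlobalNS`). Not a wrong-problem candidate.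

## ORDERED STEP INDEX (dependency order = the order `claim_of_steps` consumes them; locators = v2 pages)

* Step 1 = `Step_1` · Thm 2.2 p.2–3 («there exists T* > 0 (possibly infinite) and a unique solution …»;
  cited theory [FK_NSE], [RD_NSE], [AMAB], «easily extendable in case of external force») · rendered as
  the dichotomy GLOBAL solution of the class ∨ finite maximal `T*` with a solution of the class on `[0,T*)`.
* Step 2 = `Step_2` · Thm 2.3 p.3 («T* < ∞ if and only if lim_{t→T*} ‖u(·,t)‖_∞ = ∞»), the direction
  used on p.7: a maximal finite `T*` forces an unbounded velocity on `[0,T*)`.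
* Step 3 = `Step_3` · §1 p.2 (Helmholtz paragraph) as applied on p.3, last three lines («By applying
  Helmholtz's decomposition to u·∇u and to f we'll get u·∇u = P(u·∇u) + ∇q₁, f = P(f) + ∇q₂»): the two
  pairs exist at every time.
* Step 4 = `Step_4` · p.4 d1 «and it is −∇q₁ + ∇q₂ = ∇p».
* Step 5 = `Step_5` · p.4 d2 «We note that where ∇·(u·∇u) = 0 ⇒ u·∇u = P(u·∇u), ∇q₁ = 0, ∇p = ∇q₂» —
  with its sentence-grain companion `Step_5Abs` (the same inference for the Helmholtz pair of ANY smooth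
  field `v`, which is how the print justifies it: a property of the decomposition, FAILURE-MODES F15);
  `step5_of_abs : Step_5Abs → Step_5` PROVED.
* Step 6 = `Step_6` · p.4 d3 «particularly, this will be true where ∇u = 0, infact ∇u = 0 ⇒ 0 =
  Σ_{j,k} ∂_ju_k ∂_ku_j = ∇·(u·∇u)».
* Step 7 = `Step_7` · p.4 d4 «Let now be t ∈ (0,T*), u is a function differentiable in all variables, and
  be x̃ an absolute maximum point for |u(·,t)|, then we'll have ∇u(x̃,t) = 0» — with its sentence-grain
  companion `Step_7Abs` (any differentiable field, as the sentence argues); `step7_of_abs` PROVED.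
* Step 8 = `Step_8` · p.4 d5–d10 (ball-average computation «u(x̃,t)·Δu(x̃,t) = … = −|∇u(x̃,t)|² +
  ½Δ|u(x̃,t)|²», «but x̃ is an absolute maximum point … |∇u(x̃,t)|² = 0, Δ|u(x̃,t)|² ⩽ 0, then
  u(x̃,t)·Δu(x̃,t) = ½Δ|u(x̃,t)|² ⩽ 0»).
* (derived) `Display_p5` · p.4 d11 – p.5 d1 («we are going to substitute in the equation 1.1:
  ∂u(x̃,t)/∂t = νΔu(x̃,t) − u(x̃,t)·∇u(x̃,t) − ∇p(x̃,t) + Pf(x̃,t) + ∇q₂(x̃,t) = νΔu(x̃,t) + Pf(x̃,t)») —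
  `display_of_steps : Step_4 → Step_5 → Step_6 → Step_7 → Display_p5` PROVED (the paper's own algebra).
* Step 9 = `Step_9` · p.5 d2–d4 («u·∂ₜu = νu·Δu + u·Pf», «u·∂ₜu ⩽ u·Pf», «from which follows
  ∂|u(x̃,t)|/∂t ⩽ |Pf(x̃,t)|»).
* Step 10 = `Step_10` · p.5 d5 – p.7 d3 («By Theorem 2.2, u ∈ C¹([0,T*), C(ℝⁿ)); then the time
  derivative of ‖u(t)‖_∞ exists», the difference quotient `L₁ + L₂` along the flow map, «d‖u(t)‖_∞/dt ⩽
  lim|L₁| ⩽ ‖Pf(t)‖_∞») ⇒ (3.1) = `Theorem31`; `theorem31_of_steps : Step_3 → … → Step_10 → Theorem31`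
  PROVED.
* Step 11 = `Step_11` · p.7, proof of Thm 3.2 («integrating the inequality (3.1) we get ‖u(t)‖_∞ ⩽
  ‖u₀‖_∞ + ∫₀ᵗ‖Pf(s)‖_∞ ds», «f ∈ C^∞(ℝ^{n+1}) thus Pf ∈ C^∞(ℝ^{n+1}) so lim_{t→T*}∫₀ᵗ‖Pf(s)‖_∞ds ⩽
  T* max_{s∈[0,T*]}‖Pf(s)‖_∞ < ∞, from which lim_{t→T*}‖u(t)‖_∞ < ∞»).
* `claim_of_steps : Step_1 → Step_2 → Step_3 → Step_4 → Step_5 → Step_6 → Step_7 → Step_8 → Step_9 →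
  Step_10 → Step_11 → ClaimedTheorem` PROVED («So, for the theorem 2.3 it must be T* = ∞», p.7): the
  paper's logic composes GIVEN its steps.
* rev 2 (kernel-true steps, PROVED): `step7c_holds` (Fermat at the speed maximum), `step9_holds`,
  `step9c_holds` (Cauchy–Schwarz on p.5), and `claim_of_steps_reduced : Step_1 → Step_2 → Step_3 → Step_4 →
  Step_5min → Step_8c → Step_10 → Step_11 → ClaimedTheorem` — the charitable chain with its true steps
  discharged: modulo the classical Steps 1–4, 8c, 11 the claim hangs on `Step_5min` (pressure) and `Step_10`.

Cell record (CARD `pub/ns-claims/claims/Iotti2011/CARD.md` §4, PREDICTED 2026-08-27T01:23Z before the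
body was read): expected first failing step = Step 7 (p.4 d4), with Step 5 (p.4 d2, earlier in print and
dependency order) as the alternative; both feed `Display_p5`. Adjudicated by the refuter/referee, not here.

WHAT THIS IS NOT: not a claim about NS regularity or blow-up; not a claim about any author beyond the typed
locator.
-/

noncomputable section

open Set Function Filter MeasureTheory
open scoped Topology ENNReal NNReal ContDiff Laplacian InnerProductSpace

namespace Literature.Claims.NS.Iotti2011

open Literature.Analysis.FluidPDE
open Literature.Claims.NS.Iotti2025 (supNorm)

/-! ### Vocabulary (definitions with bodies; nothing asserted) -/

/-- The DATA CLASS of (1.1)–(1.2) p.1: `u₀ ∈ C^∞(ℝⁿ)`, `∇·u₀ = 0`, `|∂^α u₀(x)| ⩽ C_{αK}(1+|x|)^{−K}`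
for all `α`, `K` — smooth, divergence free, Clay decay (4) (the tree's `HasRapidSpatialDecay`), at `n = 3`.
[cite: Iotti2011NSLinfty, (1.1)–(1.2) p.1] -/
def IsDatum (u₀ : EuclideanSpace ℝ (Fin 3) → EuclideanSpace ℝ (Fin 3)) : Prop :=
  ContDiff ℝ ∞ u₀ ∧ VectorCalculus.IsDivFree u₀ ∧ HasRapidSpatialDecay u₀

/-- The FORCE CLASS (1.3) p.1: `|∂^α_x ∂^m_t f(x,t)| ⩽ C_{αmK}(1+|x|+t)^{−K}` on `ℝⁿ × [0,∞)` for all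
`α, m, K` — smooth on the closed half-space with Clay decay (5) (`HasRapidSpaceTimeDecay`), at `n = 3`.
[cite: Iotti2011NSLinfty, (1.3) p.1] -/
def IsForce (f : ℝ → EuclideanSpace ℝ (Fin 3) → EuclideanSpace ℝ (Fin 3)) : Prop :=
  IsSmoothOnHalfSpace f ∧ HasRapidSpaceTimeDecay f

/-- «a unique solution u ∈ C([0,T*), V^s(ℝⁿ)) ∩ C¹([0,T*), V^{s−2}(ℝⁿ)) and u ∈ C([0,T*), C²(ℝⁿ)) ∩
C¹([0,T*), C(ℝⁿ)) for Navier-Stokes's equation on ℝⁿ × (0,T*) so that u(·,0) = u₀» (Thm 2.2 p.2–3),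
RENDERED on `[0,T)` in the cell's Beale–Kato–Majda convention for the FORCED system (1.1): classical
solution with viscosity `ν` and force `f` (`u`, `p` jointly smooth, (1.1) pointwise, one-sided `∂ₜ` within
`[0,T)`), `u(0) = u₀`, and all `L²` Sobolev norms of `u(t)` (membership in `V^s`) and of `∂ₜu(t)`
(membership in `V^{s−2}`) bounded on every `[0,T'']`, `T'' < T`. TODO(general form): one `s > n/2 + 2`.
[cite: Iotti2011NSLinfty, Thm 2.2 p.2–3] -/
structure IsLocalSolution (ν T : ℝ) (u₀ : EuclideanSpace ℝ (Fin 3) → EuclideanSpace ℝ (Fin 3))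
    (f : ℝ → EuclideanSpace ℝ (Fin 3) → EuclideanSpace ℝ (Fin 3))
    (u : ℝ → EuclideanSpace ℝ (Fin 3) → EuclideanSpace ℝ (Fin 3))
    (p : ℝ → EuclideanSpace ℝ (Fin 3) → ℝ) : Prop where
  /-- (1.1) holds classically on `ℝ³ × [0,T)`, `u`, `p` jointly smooth. -/
  isClassical : IsClassicalNSSolutionOn (Ico 0 T) ν f u p
  /-- `u(x,0) = u₀(x)`. -/
  initial : u 0 = u₀
  /-- `u ∈ C([0,T*), V^s)` rendered: all Sobolev norms of `u(t)` bounded on compact sub-intervals. -/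
  sobolev : ∀ T'' < T, HasBoundedSobolevNormsOn (Icc 0 T'') u
  /-- `u ∈ C¹([0,T*), V^{s−2})` rendered: all Sobolev norms of `∂ₜu(t)` bounded on compact sub-intervals. -/
  sobolevDt : ∀ T'' < T, HasBoundedSobolevNormsOn (Icc 0 T'') (timeDerivWithin (Ico 0 T) u)

/-- The solution «extended to the whole real axis of time» (Thm 3.2 p.7; T* = ∞ in Thm 2.2), RENDERED:
classical solution of (1.1) with viscosity `ν`, force `f` on `ℝ³ × [0,∞)` from `u₀`, all `L²` Sobolev
norms of `u(t)` and `∂ₜu(t)` bounded on every `[0,T'']`. [cite: Iotti2011NSLinfty, Thm 2.2 p.2–3; Thm 3.2 p.7] -/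
structure IsGlobalSolution (ν : ℝ) (u₀ : EuclideanSpace ℝ (Fin 3) → EuclideanSpace ℝ (Fin 3))
    (f : ℝ → EuclideanSpace ℝ (Fin 3) → EuclideanSpace ℝ (Fin 3))
    (u : ℝ → EuclideanSpace ℝ (Fin 3) → EuclideanSpace ℝ (Fin 3))
    (p : ℝ → EuclideanSpace ℝ (Fin 3) → ℝ) : Prop where
  /-- (1.1) holds classically on `ℝ³ × [0,∞)`. -/
  isClassical : IsClassicalNSSolutionOn (Ici 0) ν f u p
  /-- `u(x,0) = u₀(x)`. -/
  initial : u 0 = u₀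
  /-- all Sobolev norms of `u(t)` bounded on every `[0,T'']`. -/
  sobolev : ∀ T'' : ℝ, HasBoundedSobolevNormsOn (Icc 0 T'') u
  /-- all Sobolev norms of `∂ₜu(t)` bounded on every `[0,T'']`. -/
  sobolevDt : ∀ T'' : ℝ, HasBoundedSobolevNormsOn (Icc 0 T'') (timeDerivWithin (Ici 0) u)

/-- The local solution on `[0,T)` «can be extended»: a solution OF THE CLASS on some longer `[0,T')`,
`T' > T`, agrees with `u` on `[0,T)` (the maximal time `T*` of Thm 2.2 / Thm 2.3 is a `T` at which this
fails). [cite: Iotti2011NSLinfty, Thm 2.2–2.3 p.2–3] -/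
def ExtendsPast (ν T : ℝ) (u₀ : EuclideanSpace ℝ (Fin 3) → EuclideanSpace ℝ (Fin 3))
    (f : ℝ → EuclideanSpace ℝ (Fin 3) → EuclideanSpace ℝ (Fin 3))
    (u : ℝ → EuclideanSpace ℝ (Fin 3) → EuclideanSpace ℝ (Fin 3)) : Prop :=
  ∃ T' > T, ∃ (u' : ℝ → EuclideanSpace ℝ (Fin 3) → EuclideanSpace ℝ (Fin 3))
    (p' : ℝ → EuclideanSpace ℝ (Fin 3) → ℝ), IsLocalSolution ν T' u₀ f u' p' ∧ ∀ t ∈ Ico 0 T, u' t = u t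

/-- The Helmholtz–Leray decomposition of p.2: «for al v ∈ L²(ℝⁿ) ∩ C^∞(ℝⁿ) has a unique orthogonal
decomposition v = Pv + ∇q, ∇·(Pv) = 0, q = Δ⁻¹∇·v, Pv, ∇q ∈ L²(ℝⁿ) ∩ C^∞(ℝⁿ)». `IsHelmholtzPair v w q`
says that `(w, q)` IS such a decomposition of `v` (`w` in the role of `Pv`): `v = w + ∇q` pointwise,
`∇·w = 0`, `w` and `q` smooth, `w` and `∇q` square integrable. (By `L²` orthogonality of divergence-free
fields and gradients the pair is unique, so `w = Pv`; no inverse Laplacian is introduced.)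
[cite: Iotti2011NSLinfty, §1 p.2] -/
structure IsHelmholtzPair (v w : EuclideanSpace ℝ (Fin 3) → EuclideanSpace ℝ (Fin 3))
    (q : EuclideanSpace ℝ (Fin 3) → ℝ) : Prop where
  /-- `Pv ∈ C^∞`. -/
  smooth_left : ContDiff ℝ ∞ w
  /-- `q ∈ C^∞` (so `∇q ∈ C^∞`). -/
  smooth_potential : ContDiff ℝ ∞ q
  /-- `v = Pv + ∇q`. -/
  decomp : ∀ x, v x = w x + gradient q x
  /-- `∇·(Pv) = 0`. -/
  divFree : VectorCalculus.IsDivFree w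
  /-- `Pv ∈ L²`. -/
  sqIntegrable_left : Integrable (fun x => ‖w x‖ ^ 2)
  /-- `∇q ∈ L²`. -/
  sqIntegrable_grad : Integrable (fun x => ‖gradient q x‖ ^ 2)

/-- «x̃ an absolute maximum point for |u(·,t)|» (p.4): `|v(y)| ⩽ |v(x̃)|` for every `y`.
[cite: Iotti2011NSLinfty, proof of Thm 3.1 p.4] -/
def IsAbsMax (v : EuclideanSpace ℝ (Fin 3) → EuclideanSpace ℝ (Fin 3)) (x : EuclideanSpace ℝ (Fin 3)) :
    Prop :=
  ∀ y, ‖v y‖ ≤ ‖v x‖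

/-! ### The claimed statements (p. 3, p. 7) -/

/-- **Theorem 3.2 (p.7) «In the hypotheses of the Theorem 3.1, the solution u can be extended to the whole
real axis of time»**, read with Theorem 2.2 (a local solution exists for every admissible datum) as the
abstract states it («a theorem of global time-extension for the local classical solution of
Navier-Stokes's evolution problem in ℝⁿ with n ⩾ 2 for incompressible fluids subjected to external forces
and regular initial conditions»): for every `ν ⩾ 0` («μ ⩾ 0», Euler included as printed), every datum
(1.2) and every force (1.3) there is a global solution of the class. (The literal continuation phrasing —
THE local solution extends — is this plus the uniqueness of Thm 2.2; not load-bearing.)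
[claim: Iotti2011NSLinfty, status: disputed] -/
def ClaimedTheorem : Prop :=
  ∀ ν : ℝ, 0 ≤ ν →
    ∀ (u₀ : EuclideanSpace ℝ (Fin 3) → EuclideanSpace ℝ (Fin 3))
      (f : ℝ → EuclideanSpace ℝ (Fin 3) → EuclideanSpace ℝ (Fin 3)), IsDatum u₀ → IsForce f →
      ∃ (u : ℝ → EuclideanSpace ℝ (Fin 3) → EuclideanSpace ℝ (Fin 3))
        (p : ℝ → EuclideanSpace ℝ (Fin 3) → ℝ), IsGlobalSolution ν u₀ f u p

/-- **Theorem 3.1 (p.3), (3.1) «d‖u(t)‖_∞/dt ⩽ ‖Pf(t)‖_∞» for t ∈ (0,T*)**, for every solution of the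
class on `[0,T)` and every Helmholtz family `(Pf, q₂)` of the force, AS PRINTED: the derivative of
`t ↦ ‖u(t)‖_∞` EXISTS at every `t ∈ (0,T)` (p.5 «then the time derivative of ‖u(t)‖_∞ exists») and is
bounded by `‖Pf(t)‖_∞`. [claim: Iotti2011NSLinfty, status: disputed] -/
def Theorem31 : Prop :=
  ∀ ν : ℝ, 0 ≤ ν →
    ∀ (u₀ : EuclideanSpace ℝ (Fin 3) → EuclideanSpace ℝ (Fin 3))
      (f : ℝ → EuclideanSpace ℝ (Fin 3) → EuclideanSpace ℝ (Fin 3)), IsDatum u₀ → IsForce f →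
      ∀ T : ℝ, 0 < T →
        ∀ (u : ℝ → EuclideanSpace ℝ (Fin 3) → EuclideanSpace ℝ (Fin 3))
          (p : ℝ → EuclideanSpace ℝ (Fin 3) → ℝ), IsLocalSolution ν T u₀ f u p →
          ∀ (w₂ : ℝ → EuclideanSpace ℝ (Fin 3) → EuclideanSpace ℝ (Fin 3))
            (q₂ : ℝ → EuclideanSpace ℝ (Fin 3) → ℝ),
            (∀ s ∈ Ico 0 T, IsHelmholtzPair (f s) (w₂ s) (q₂ s)) →
            ∀ t ∈ Ioo 0 T, ∃ D : ℝ, HasDerivAt (fun s => supNorm (u s)) D t ∧ D ≤ supNorm (w₂ t)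

/-! ### The paper's steps (no assertion) -/

/-- **Step 1 — Theorem 2.2 (p.2–3, «Existence of local solutions to Navier-Stokes's problem»; results
«report[ed] without proof … obtained for the first time by Kato and Fujita», «easily extendable in case
of external force f(x,t) ∈ 𝒮(ℝ^{n+1})»): «Let s > n/2 + 2. For all u₀ ∈ V^s(ℝⁿ), there exists T* > 0
(possibly infinite) and a unique solution u ∈ C([0,T*), V^s) ∩ C¹([0,T*), V^{s−2}) …»**, RENDERED as the
dichotomy it is used for (p.7): for every `ν ⩾ 0`, datum and force of the classes, EITHER a global
solution of the class exists (`T* = ∞`) OR there are a finite `T* > 0` and a solution of the class on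
`[0,T*)` that does not extend in the class (`T*` maximal). Uniqueness is not load-bearing and not typed.
(Classical for `ν > 0`; stated for «μ ⩾ 0» as printed.) [cite: Iotti2011NSLinfty, Thm 2.2 p.2–3] -/
def Step_1 : Prop :=
  ∀ ν : ℝ, 0 ≤ ν →
    ∀ (u₀ : EuclideanSpace ℝ (Fin 3) → EuclideanSpace ℝ (Fin 3))
      (f : ℝ → EuclideanSpace ℝ (Fin 3) → EuclideanSpace ℝ (Fin 3)), IsDatum u₀ → IsForce f →
      (∃ (u : ℝ → EuclideanSpace ℝ (Fin 3) → EuclideanSpace ℝ (Fin 3))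
          (p : ℝ → EuclideanSpace ℝ (Fin 3) → ℝ), IsGlobalSolution ν u₀ f u p) ∨
      (∃ T : ℝ, 0 < T ∧
        ∃ (u : ℝ → EuclideanSpace ℝ (Fin 3) → EuclideanSpace ℝ (Fin 3))
          (p : ℝ → EuclideanSpace ℝ (Fin 3) → ℝ), IsLocalSolution ν T u₀ f u p ∧ ¬ ExtendsPast ν T u₀ f u)

/-- **Step 2 — Theorem 2.3 (p.3): «Solution u described in Theorem 2.2 is u(·,t) ∈ C(ℝⁿ) for t ∈ (0,T*),
furthermore, for the maximal time of existence, it is T* < ∞ if and only if lim_{t→T*} ‖u(·,t)‖_∞ = ∞»**,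
the direction used on p.7 («So, for the theorem 2.3 it must be T* = ∞»), RENDERED without suprema
(TYPING-HYGIENE 1): a solution of the class on `[0,T)`, `T < ∞`, that does not extend in the class has an
UNBOUNDED velocity on `[0,T) × ℝ³` (weaker than the printed `lim = ∞`; it is all the proof of Thm 3.2
consumes). Every `ν ⩾ 0` as printed (classical for `ν > 0`: a Prodi–Serrin class; for `ν = 0` the
velocity sup-norm criterion is not a classical continuation principle — cf. C28b `Iotti2025.Step_2E`).
[claim: Iotti2011NSLinfty, status: disputed] -/
def Step_2 : Prop :=
  ∀ ν : ℝ, 0 ≤ ν →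
    ∀ (u₀ : EuclideanSpace ℝ (Fin 3) → EuclideanSpace ℝ (Fin 3))
      (f : ℝ → EuclideanSpace ℝ (Fin 3) → EuclideanSpace ℝ (Fin 3)), IsDatum u₀ → IsForce f →
      ∀ T : ℝ, 0 < T →
        ∀ (u : ℝ → EuclideanSpace ℝ (Fin 3) → EuclideanSpace ℝ (Fin 3))
          (p : ℝ → EuclideanSpace ℝ (Fin 3) → ℝ), IsLocalSolution ν T u₀ f u p → ¬ ExtendsPast ν T u₀ f u →
          ∀ M : ℝ, ∃ t ∈ Ico 0 T, ∃ x, M < ‖u t x‖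

/-- **Step 3 — the Helmholtz decompositions used (p.2 «for al v ∈ L² ∩ C^∞ has a unique orthogonal
decomposition v = Pv + ∇q», applied on p.3, last lines of the page: «By applying Helmholtz's
decomposition to u·∇u and to f we'll get u·∇u = P(u·∇u) + ∇q₁, f = P(f) + ∇q₂»)**: for every solution of
the class on `[0,T)` there are time-indexed Helmholtz pairs `(P(u·∇u), q₁)` of `u·∇u(t)` and `(Pf, q₂)`
of `f(t)`, `t ∈ [0,T)`. (Classical: both fields are smooth and square integrable in the class.)
[cite: Iotti2011NSLinfty, §1 p.2; proof of Thm 3.1 p.3] -/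
def Step_3 : Prop :=
  ∀ ν : ℝ, 0 ≤ ν →
    ∀ (u₀ : EuclideanSpace ℝ (Fin 3) → EuclideanSpace ℝ (Fin 3))
      (f : ℝ → EuclideanSpace ℝ (Fin 3) → EuclideanSpace ℝ (Fin 3)), IsDatum u₀ → IsForce f →
      ∀ T : ℝ, 0 < T →
        ∀ (u : ℝ → EuclideanSpace ℝ (Fin 3) → EuclideanSpace ℝ (Fin 3))
          (p : ℝ → EuclideanSpace ℝ (Fin 3) → ℝ), IsLocalSolution ν T u₀ f u p →
          ∃ (w₁ : ℝ → EuclideanSpace ℝ (Fin 3) → EuclideanSpace ℝ (Fin 3))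
            (q₁ : ℝ → EuclideanSpace ℝ (Fin 3) → ℝ)
            (w₂ : ℝ → EuclideanSpace ℝ (Fin 3) → EuclideanSpace ℝ (Fin 3))
            (q₂ : ℝ → EuclideanSpace ℝ (Fin 3) → ℝ),
            ∀ t ∈ Ico 0 T,
              IsHelmholtzPair (convect (u t) (u t)) (w₁ t) (q₁ t) ∧ IsHelmholtzPair (f t) (w₂ t) (q₂ t)

/-- **Step 4 — p.4 d1 «and it is −∇q₁ + ∇q₂ = ∇p»**: for every solution of the class, every `t ∈ [0,T)`
and all Helmholtz pairs of `u·∇u(t)` and `f(t)`, the pressure gradient is `∇q₂ − ∇q₁` at every point.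
(True for the decaying (Leray) pressure; in the class `∇p(t) ∈ L²` because `∂ₜu(t)`, `Δu(t)`, `u·∇u(t)`,
`f(t)` are.) [claim: Iotti2011NSLinfty, status: disputed] -/
def Step_4 : Prop :=
  ∀ ν : ℝ, 0 ≤ ν →
    ∀ (u₀ : EuclideanSpace ℝ (Fin 3) → EuclideanSpace ℝ (Fin 3))
      (f : ℝ → EuclideanSpace ℝ (Fin 3) → EuclideanSpace ℝ (Fin 3)), IsDatum u₀ → IsForce f →
      ∀ T : ℝ, 0 < T →
        ∀ (u : ℝ → EuclideanSpace ℝ (Fin 3) → EuclideanSpace ℝ (Fin 3))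
          (p : ℝ → EuclideanSpace ℝ (Fin 3) → ℝ), IsLocalSolution ν T u₀ f u p →
          ∀ t ∈ Ico 0 T,
            ∀ (w₁ : EuclideanSpace ℝ (Fin 3) → EuclideanSpace ℝ (Fin 3)) (q₁ : EuclideanSpace ℝ (Fin 3) → ℝ)
              (w₂ : EuclideanSpace ℝ (Fin 3) → EuclideanSpace ℝ (Fin 3)) (q₂ : EuclideanSpace ℝ (Fin 3) → ℝ),
              IsHelmholtzPair (convect (u t) (u t)) w₁ q₁ → IsHelmholtzPair (f t) w₂ q₂ →
              ∀ x, gradient (p t) x = gradient q₂ x - gradient q₁ x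

/-- **Step 5Abs — p.4 d2 at the grain of its justification (FAILURE-MODES F15): the Helmholtz
decomposition read POINTWISE.** The printed inference «where ∇·(u·∇u) = 0 ⇒ u·∇u = P(u·∇u), ∇q₁ = 0»
uses nothing about `u·∇u` except its decomposition, i.e. it is the sentence: for every smooth field `v`
with Helmholtz pair `(Pv, q)` and every point `x`, if `∇·v(x) = 0` then `∇q(x) = 0` and `v(x) = Pv(x)`.
(`P = I − ∇Δ⁻¹∇·` is non-local; `q` is only harmonic near such `x`.) [claim: Iotti2011NSLinfty, status: disputed] -/
def Step_5Abs : Prop :=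
  ∀ (v w : EuclideanSpace ℝ (Fin 3) → EuclideanSpace ℝ (Fin 3)) (q : EuclideanSpace ℝ (Fin 3) → ℝ),
    ContDiff ℝ ∞ v → IsHelmholtzPair v w q →
    ∀ x, VectorCalculus.divergence v x = 0 → gradient q x = 0 ∧ v x = w x

/-- **Step 5 — p.4 d2 «We note that where ∇·(u·∇u) = 0 ⇒ u·∇u = P(u·∇u), ∇q₁ = 0, ∇p = ∇q₂»** for THE
field `u·∇u(t)` of a solution of the class and its Helmholtz pair: at every point where `∇·(u·∇u)`
vanishes, `∇q₁ = 0` and `u·∇u = P(u·∇u)` (then `∇p = ∇q₂` there by Step 4). The solution-grain instance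
of `Step_5Abs` (`step5_of_abs`). [claim: Iotti2011NSLinfty, status: disputed] -/
def Step_5 : Prop :=
  ∀ ν : ℝ, 0 ≤ ν →
    ∀ (u₀ : EuclideanSpace ℝ (Fin 3) → EuclideanSpace ℝ (Fin 3))
      (f : ℝ → EuclideanSpace ℝ (Fin 3) → EuclideanSpace ℝ (Fin 3)), IsDatum u₀ → IsForce f →
      ∀ T : ℝ, 0 < T →
        ∀ (u : ℝ → EuclideanSpace ℝ (Fin 3) → EuclideanSpace ℝ (Fin 3))
          (p : ℝ → EuclideanSpace ℝ (Fin 3) → ℝ), IsLocalSolution ν T u₀ f u p →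
          ∀ t ∈ Ico 0 T,
            ∀ (w₁ : EuclideanSpace ℝ (Fin 3) → EuclideanSpace ℝ (Fin 3)) (q₁ : EuclideanSpace ℝ (Fin 3) → ℝ),
              IsHelmholtzPair (convect (u t) (u t)) w₁ q₁ →
              ∀ x, VectorCalculus.divergence (convect (u t) (u t)) x = 0 →
                gradient q₁ x = 0 ∧ convect (u t) (u t) x = w₁ x

/-- **Step 6 — p.4 d3 «particularly, this will be true where ∇u = 0, infact ∇u = 0 ⇒ 0 =
Σ_{j,k} ∂_ju_k ∂_ku_j = ∇·(u·∇u)»**: at a point where the full gradient of `u(t)` vanishes, the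
divergence of `u·∇u(t)` vanishes (for a solution of the class; `∇·u = 0` kills the term `u·∇(∇·u)`).
(True; elementary.) [claim: Iotti2011NSLinfty, status: disputed] -/
def Step_6 : Prop :=
  ∀ ν : ℝ, 0 ≤ ν →
    ∀ (u₀ : EuclideanSpace ℝ (Fin 3) → EuclideanSpace ℝ (Fin 3))
      (f : ℝ → EuclideanSpace ℝ (Fin 3) → EuclideanSpace ℝ (Fin 3)), IsDatum u₀ → IsForce f →
      ∀ T : ℝ, 0 < T →
        ∀ (u : ℝ → EuclideanSpace ℝ (Fin 3) → EuclideanSpace ℝ (Fin 3))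
          (p : ℝ → EuclideanSpace ℝ (Fin 3) → ℝ), IsLocalSolution ν T u₀ f u p →
          ∀ t ∈ Ico 0 T, ∀ x, fderiv ℝ (u t) x = 0 → VectorCalculus.divergence (convect (u t) (u t)) x = 0

/-- **Step 7Abs — p.4 d4 at the grain of its justification (FAILURE-MODES F15): «u is a function
differentiable in all variables, and be x̃ an absolute maximum point for |u(·,t)|, then we'll have
∇u(x̃,t) = 0»** read as the calculus sentence it invokes: for every differentiable field `v : ℝ³ → ℝ³` and
every absolute maximum point `x̃` of `|v|`, the (full) derivative `∇v(x̃)` vanishes. (At a maximum of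
`|v|²` one has `∇|v|²(x̃) = 2(∇v)ᵀv(x̃) = 0`.) [claim: Iotti2011NSLinfty, status: disputed] -/
def Step_7Abs : Prop :=
  ∀ v : EuclideanSpace ℝ (Fin 3) → EuclideanSpace ℝ (Fin 3), Differentiable ℝ v →
    ∀ x : EuclideanSpace ℝ (Fin 3), IsAbsMax v x → fderiv ℝ v x = 0

/-- **Step 7 — p.4 d4 «Let now be t ∈ (0,T*), u is a function differentiable in all variables, and be x̃
an absolute maximum point for |u(·,t)|, then we'll have ∇u(x̃,t) = 0»** for solutions of the class:
at every `t ∈ (0,T)` and every absolute maximum point `x̃` of `|u(·,t)|`, `∇u(x̃,t) = 0` (the full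
Jacobian `fderiv`). The solution-grain instance of `Step_7Abs` (`step7_of_abs`).
[claim: Iotti2011NSLinfty, status: disputed] -/
def Step_7 : Prop :=
  ∀ ν : ℝ, 0 ≤ ν →
    ∀ (u₀ : EuclideanSpace ℝ (Fin 3) → EuclideanSpace ℝ (Fin 3))
      (f : ℝ → EuclideanSpace ℝ (Fin 3) → EuclideanSpace ℝ (Fin 3)), IsDatum u₀ → IsForce f →
      ∀ T : ℝ, 0 < T →
        ∀ (u : ℝ → EuclideanSpace ℝ (Fin 3) → EuclideanSpace ℝ (Fin 3))
          (p : ℝ → EuclideanSpace ℝ (Fin 3) → ℝ), IsLocalSolution ν T u₀ f u p →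
          ∀ t ∈ Ioo 0 T, ∀ x, IsAbsMax (u t) x → fderiv ℝ (u t) x = 0

/-- **Step 8 — p.4 d5–d10: «u(x̃,t)·Δu(x̃,t) = lim_{r→0} (1/|B(x̃,r)|)∫_{B(x̃,r)}(u·Δu)dx = … =
−|∇u(x̃,t)|² + ½Δ|u(x̃,t)|²», «but x̃ is an absolute maximum point for |u(·,t)|, |∇u(x̃,t)|² = 0,
Δ|u(x̃,t)|² ⩽ 0, then u(x̃,t)·Δu(x̃,t) = ½Δ|u(x̃,t)|² ⩽ 0»** — typed as the implication the print draws at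
an absolute maximum point where (by Step 7) `∇u(x̃,t) = 0`: `u·Δu = ½Δ|u|²` there and `Δ|u|² ⩽ 0` there.
(True: `u·Δu = ½Δ|u|² − |∇u|²` pointwise and the Laplacian of a `C²` function is `⩽ 0` at a maximum.)
[claim: Iotti2011NSLinfty, status: disputed] -/
def Step_8 : Prop :=
  ∀ ν : ℝ, 0 ≤ ν →
    ∀ (u₀ : EuclideanSpace ℝ (Fin 3) → EuclideanSpace ℝ (Fin 3))
      (f : ℝ → EuclideanSpace ℝ (Fin 3) → EuclideanSpace ℝ (Fin 3)), IsDatum u₀ → IsForce f →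
      ∀ T : ℝ, 0 < T →
        ∀ (u : ℝ → EuclideanSpace ℝ (Fin 3) → EuclideanSpace ℝ (Fin 3))
          (p : ℝ → EuclideanSpace ℝ (Fin 3) → ℝ), IsLocalSolution ν T u₀ f u p →
          ∀ t ∈ Ioo 0 T, ∀ x, IsAbsMax (u t) x → fderiv ℝ (u t) x = 0 →
            ⟪u t x, Δ (u t) x⟫_ℝ = (1 / 2 : ℝ) * Δ (fun y => ‖u t y‖ ^ 2) x ∧
              Δ (fun y => ‖u t y‖ ^ 2) x ≤ 0

/-- **The substituted equation, p.4 d11 – p.5 d1: «To estimate the derivative of u in (x̃,t) with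
respect to time, we are going to substitute in the equation 1.1: ∂u(x̃,t)/∂t = νΔu(x̃,t) −
u(x̃,t)·∇u(x̃,t) − ∇p(x̃,t) + Pf(x̃,t) + ∇q₂(x̃,t) = νΔu(x̃,t) + Pf(x̃,t)»** at every absolute maximum
point `x̃` of `|u(·,t)|`, `t ∈ (0,T)`, for every solution of the class and all Helmholtz pairs. DERIVED
by the paper from Steps 4–7 (`display_of_steps`); recorded as a named display, not an extra step.
[claim: Iotti2011NSLinfty, status: disputed] -/
def Display_p5 : Prop :=
  ∀ ν : ℝ, 0 ≤ ν →
    ∀ (u₀ : EuclideanSpace ℝ (Fin 3) → EuclideanSpace ℝ (Fin 3))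
      (f : ℝ → EuclideanSpace ℝ (Fin 3) → EuclideanSpace ℝ (Fin 3)), IsDatum u₀ → IsForce f →
      ∀ T : ℝ, 0 < T →
        ∀ (u : ℝ → EuclideanSpace ℝ (Fin 3) → EuclideanSpace ℝ (Fin 3))
          (p : ℝ → EuclideanSpace ℝ (Fin 3) → ℝ), IsLocalSolution ν T u₀ f u p →
          ∀ t ∈ Ioo 0 T, ∀ x, IsAbsMax (u t) x →
            ∀ (w₁ : EuclideanSpace ℝ (Fin 3) → EuclideanSpace ℝ (Fin 3)) (q₁ : EuclideanSpace ℝ (Fin 3) → ℝ)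
              (w₂ : EuclideanSpace ℝ (Fin 3) → EuclideanSpace ℝ (Fin 3)) (q₂ : EuclideanSpace ℝ (Fin 3) → ℝ),
              IsHelmholtzPair (convect (u t) (u t)) w₁ q₁ → IsHelmholtzPair (f t) w₂ q₂ →
              timeDerivWithin (Ico 0 T) u t x = ν • Δ (u t) x + w₂ x

/-- **Step 9 — p.5 d2–d4: «u(x̃,t)·∂u(x̃,t)/∂t = νu(x̃,t)·Δu(x̃,t) + u(x̃,t)·Pf(x̃,t)», «u(x̃,t)·∂u(x̃,t)/∂t
⩽ u(x̃,t)·Pf(x̃,t)», «from which follows ∂|u(x̃,t)|/∂t ⩽ |Pf(x̃,t)|»** — typed as the implication at an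
absolute maximum point `x̃`, `t ∈ (0,T)`: IF `∂ₜu(x̃,t) = νΔu(x̃,t) + Pf(x̃,t)` (the display of p.5) and
`u·Δu(x̃,t) ⩽ 0` (Step 8), THEN every time derivative `D` of `s ↦ |u(x̃,s)|` at `t` (within `[0,T)`)
satisfies `D ⩽ |Pf(x̃,t)|` (stated for whatever derivative exists: no differentiability of the norm is
asserted). (True: Cauchy–Schwarz; at `u(x̃,t) = 0` an interior derivative of the non-negative `|u(x̃,·)|`
is `0`.) [claim: Iotti2011NSLinfty, status: disputed] -/
def Step_9 : Prop :=
  ∀ ν : ℝ, 0 ≤ ν →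
    ∀ (u₀ : EuclideanSpace ℝ (Fin 3) → EuclideanSpace ℝ (Fin 3))
      (f : ℝ → EuclideanSpace ℝ (Fin 3) → EuclideanSpace ℝ (Fin 3)), IsDatum u₀ → IsForce f →
      ∀ T : ℝ, 0 < T →
        ∀ (u : ℝ → EuclideanSpace ℝ (Fin 3) → EuclideanSpace ℝ (Fin 3))
          (p : ℝ → EuclideanSpace ℝ (Fin 3) → ℝ), IsLocalSolution ν T u₀ f u p →
          ∀ t ∈ Ioo 0 T, ∀ x, IsAbsMax (u t) x →
            ∀ (w₂ : EuclideanSpace ℝ (Fin 3) → EuclideanSpace ℝ (Fin 3)) (q₂ : EuclideanSpace ℝ (Fin 3) → ℝ),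
              IsHelmholtzPair (f t) w₂ q₂ →
              timeDerivWithin (Ico 0 T) u t x = ν • Δ (u t) x + w₂ x → ⟪u t x, Δ (u t) x⟫_ℝ ≤ 0 →
              ∀ D : ℝ, HasDerivWithinAt (fun s => ‖u s x‖) D (Ico 0 T) t → D ≤ ‖w₂ x‖

/-- **Step 10 — p.5 d5 – p.7 d3: «By Theorem 2.2, u ∈ C¹([0,T*), C(ℝⁿ)); then the time derivative of
‖u(t)‖_∞ exists, thus: d‖u(t)‖_∞/dt = lim_{h→0⁺} (|u(x̃_h,t+h)| − |u(x̃,t)|)/h … = L₁ + L₂» (x̃_h the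
absolute maximum point at time t+h, x̃*_h its pre-image under the flow map (1.4)), «Being x̃_h a point of
maximum at time (t+h), for what we have seen so far, it is ∇|u(x̃_h,t+h)| = 0, ∂|u(x̃_h,t+h)|/∂t ⩽
|Pf(x̃_h,t+h)|», «lim |L₁| ⩽ |Pf(x̃₀*,t)| ⩽ ‖Pf(t)‖_∞», «lim_{h→0⁺} L₂ ⩽ 0», «thus d‖u(t)‖_∞/dt ⩽ …
⩽ ‖Pf(t)‖_∞»** — typed as the implication for a solution of the class and a Helmholtz family of the
force: IF at every `s ∈ (0,T)` and every absolute maximum point of `|u(·,s)|` the pointwise bound of Step 9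
holds, THEN at every `t ∈ (0,T)` the derivative of `‖u(·)‖_∞` EXISTS and is `⩽ ‖Pf(t)‖_∞` (the envelope
argument; the existence of the derivative is asserted by the print — Danskin's theorem gives the Dini
form). [claim: Iotti2011NSLinfty, status: disputed] -/
def Step_10 : Prop :=
  ∀ ν : ℝ, 0 ≤ ν →
    ∀ (u₀ : EuclideanSpace ℝ (Fin 3) → EuclideanSpace ℝ (Fin 3))
      (f : ℝ → EuclideanSpace ℝ (Fin 3) → EuclideanSpace ℝ (Fin 3)), IsDatum u₀ → IsForce f →
      ∀ T : ℝ, 0 < T →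
        ∀ (u : ℝ → EuclideanSpace ℝ (Fin 3) → EuclideanSpace ℝ (Fin 3))
          (p : ℝ → EuclideanSpace ℝ (Fin 3) → ℝ), IsLocalSolution ν T u₀ f u p →
          ∀ (w₂ : ℝ → EuclideanSpace ℝ (Fin 3) → EuclideanSpace ℝ (Fin 3))
            (q₂ : ℝ → EuclideanSpace ℝ (Fin 3) → ℝ),
            (∀ s ∈ Ico 0 T, IsHelmholtzPair (f s) (w₂ s) (q₂ s)) →
            (∀ s ∈ Ioo 0 T, ∀ x, IsAbsMax (u s) x →
              ∀ D : ℝ, HasDerivWithinAt (fun τ => ‖u τ x‖) D (Ico 0 T) s → D ≤ ‖w₂ s x‖) →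
            ∀ t ∈ Ioo 0 T, ∃ D : ℝ, HasDerivAt (fun s => supNorm (u s)) D t ∧ D ≤ supNorm (w₂ t)

/-- **Step 11 — proof of Theorem 3.2 (p.7): «Let's suppose T* < ∞ and t ∈ (0,T*), integrating the
inequality 3.1 we get ‖u(t)‖_∞ ⩽ ‖u₀‖_∞ + ∫₀ᵗ ‖Pf(s)‖_∞ ds», «f ∈ C^∞(ℝ^{n+1}) thus Pf ∈ C^∞(ℝ^{n+1}) so
lim_{t→T*} ∫₀ᵗ‖Pf(s)‖_∞ds ⩽ T* max_{s∈[0,T*]} ‖Pf(s)‖_∞ < ∞, from which lim_{t→T*} ‖u(t)‖_∞ < ∞»** —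
typed as the implication for a solution of the class on a finite `[0,T)` and a Helmholtz family of the
force: (3.1) on `(0,T)` ⇒ the velocity is UNIFORMLY bounded on `[0,T) × ℝ³` (what Thm 2.3 consumes).
(True in the class: `‖Pf(s)‖_∞` is bounded on `[0,T]` for a force (1.3), and the class bounds `‖u(t)‖_∞`
on compact sub-intervals.) [claim: Iotti2011NSLinfty, status: disputed] -/
def Step_11 : Prop :=
  ∀ ν : ℝ, 0 ≤ ν →
    ∀ (u₀ : EuclideanSpace ℝ (Fin 3) → EuclideanSpace ℝ (Fin 3))
      (f : ℝ → EuclideanSpace ℝ (Fin 3) → EuclideanSpace ℝ (Fin 3)), IsDatum u₀ → IsForce f →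
      ∀ T : ℝ, 0 < T →
        ∀ (u : ℝ → EuclideanSpace ℝ (Fin 3) → EuclideanSpace ℝ (Fin 3))
          (p : ℝ → EuclideanSpace ℝ (Fin 3) → ℝ), IsLocalSolution ν T u₀ f u p →
          ∀ (w₂ : ℝ → EuclideanSpace ℝ (Fin 3) → EuclideanSpace ℝ (Fin 3))
            (q₂ : ℝ → EuclideanSpace ℝ (Fin 3) → ℝ),
            (∀ s ∈ Ico 0 T, IsHelmholtzPair (f s) (w₂ s) (q₂ s)) →
            (∀ t ∈ Ioo 0 T, ∃ D : ℝ, HasDerivAt (fun s => supNorm (u s)) D t ∧ D ≤ supNorm (w₂ t)) →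
            ∃ M : ℝ, ∀ t ∈ Ico 0 T, ∀ x, ‖u t x‖ ≤ M

/-! ### The charitable (u-dotted) chain — recorded for the referee's pass (REF-PROTOCOL: maximally
charitable re-typing before a «false lemma» verdict). Dotting (1.1) with `u(x̃,t)` at an absolute maximum
point needs only the first-order condition `∇|u|²(x̃,t) = 0` (true) in place of Step 7, only `u·Δu ⩽ 0`
(true) in place of Step 8, and only `u(x̃,t)·∇q₁(x̃,t) = 0` in place of Steps 5–6: the minimal
load-bearing form of p.4 d2 is `Step_5min` (the pressure term). Nothing asserted. -/

/-- **Step 5min — the weakest form of p.4 d2 («… ∇q₁ = 0, ∇p = ∇q₂» at the maximum point) that the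
u-dotted chain p.5 d2–d4 consumes**: for every solution of the class, every `t ∈ (0,T)`, every absolute
maximum point `x̃` of `|u(·,t)|` and the Helmholtz pair `(P(u·∇u), q₁)` of `u·∇u(t)`: `u(x̃,t)·∇q₁(x̃,t)
= 0` (equivalently `u(x̃,t) ⊥ P(u·∇u)(x̃,t)`, since `u·(u·∇u)(x̃) = ½u·∇|u|²(x̃) = 0`). The non-local
(pressure) content of Theorem 3.1. [claim: Iotti2011NSLinfty, status: disputed] -/
def Step_5min : Prop :=
  ∀ ν : ℝ, 0 ≤ ν →
    ∀ (u₀ : EuclideanSpace ℝ (Fin 3) → EuclideanSpace ℝ (Fin 3))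
      (f : ℝ → EuclideanSpace ℝ (Fin 3) → EuclideanSpace ℝ (Fin 3)), IsDatum u₀ → IsForce f →
      ∀ T : ℝ, 0 < T →
        ∀ (u : ℝ → EuclideanSpace ℝ (Fin 3) → EuclideanSpace ℝ (Fin 3))
          (p : ℝ → EuclideanSpace ℝ (Fin 3) → ℝ), IsLocalSolution ν T u₀ f u p →
          ∀ t ∈ Ioo 0 T, ∀ x, IsAbsMax (u t) x →
            ∀ (w₁ : EuclideanSpace ℝ (Fin 3) → EuclideanSpace ℝ (Fin 3)) (q₁ : EuclideanSpace ℝ (Fin 3) → ℝ),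
              IsHelmholtzPair (convect (u t) (u t)) w₁ q₁ → ⟪u t x, gradient q₁ x⟫_ℝ = 0

/-- **Step 7c — the charitable reading of p.4 d4** (what «x̃ an absolute maximum point for |u(·,t)|»
gives by Fermat's theorem, and what p.6 d3 «∇|u(x̃_h,t+h)| = 0» actually states): the first-order
condition `∇|u|²(x̃,t) = 0`, i.e. `u(x̃,t)·(∇u(x̃,t)h) = 0` for every direction `h`; in particular
`u·(u·∇u)(x̃,t) = 0`. (True.) [claim: Iotti2011NSLinfty, status: disputed] -/
def Step_7c : Prop :=
  ∀ ν : ℝ, 0 ≤ ν →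
    ∀ (u₀ : EuclideanSpace ℝ (Fin 3) → EuclideanSpace ℝ (Fin 3))
      (f : ℝ → EuclideanSpace ℝ (Fin 3) → EuclideanSpace ℝ (Fin 3)), IsDatum u₀ → IsForce f →
      ∀ T : ℝ, 0 < T →
        ∀ (u : ℝ → EuclideanSpace ℝ (Fin 3) → EuclideanSpace ℝ (Fin 3))
          (p : ℝ → EuclideanSpace ℝ (Fin 3) → ℝ), IsLocalSolution ν T u₀ f u p →
          ∀ t ∈ Ioo 0 T, ∀ x, IsAbsMax (u t) x → ∀ h : EuclideanSpace ℝ (Fin 3), ⟪u t x, fderiv ℝ (u t) x h⟫_ℝ = 0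

/-- **Step 8c — the charitable reading of p.4 d10** («u(x̃,t)·Δu(x̃,t) ⩽ 0» at an absolute maximum point,
which holds WITHOUT `∇u(x̃,t) = 0`: `u·Δu = ½Δ|u|² − |∇u|² ⩽ 0`). (True.) [claim: Iotti2011NSLinfty, status: disputed] -/
def Step_8c : Prop :=
  ∀ ν : ℝ, 0 ≤ ν →
    ∀ (u₀ : EuclideanSpace ℝ (Fin 3) → EuclideanSpace ℝ (Fin 3))
      (f : ℝ → EuclideanSpace ℝ (Fin 3) → EuclideanSpace ℝ (Fin 3)), IsDatum u₀ → IsForce f →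
      ∀ T : ℝ, 0 < T →
        ∀ (u : ℝ → EuclideanSpace ℝ (Fin 3) → EuclideanSpace ℝ (Fin 3))
          (p : ℝ → EuclideanSpace ℝ (Fin 3) → ℝ), IsLocalSolution ν T u₀ f u p →
          ∀ t ∈ Ioo 0 T, ∀ x, IsAbsMax (u t) x → ⟪u t x, Δ (u t) x⟫_ℝ ≤ 0

/-- **The u-dotted substituted equation, p.5 d2 «u(x̃,t)·∂u(x̃,t)/∂t = νu(x̃,t)·Δu(x̃,t) +
u(x̃,t)·Pf(x̃,t)»** at every absolute maximum point, for every solution of the class and all Helmholtz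
pairs. DERIVED from Steps 4, 5min, 7c (`displayDot_of_steps`). [claim: Iotti2011NSLinfty, status: disputed] -/
def Display_p5_dot : Prop :=
  ∀ ν : ℝ, 0 ≤ ν →
    ∀ (u₀ : EuclideanSpace ℝ (Fin 3) → EuclideanSpace ℝ (Fin 3))
      (f : ℝ → EuclideanSpace ℝ (Fin 3) → EuclideanSpace ℝ (Fin 3)), IsDatum u₀ → IsForce f →
      ∀ T : ℝ, 0 < T →
        ∀ (u : ℝ → EuclideanSpace ℝ (Fin 3) → EuclideanSpace ℝ (Fin 3))
          (p : ℝ → EuclideanSpace ℝ (Fin 3) → ℝ), IsLocalSolution ν T u₀ f u p →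
          ∀ t ∈ Ioo 0 T, ∀ x, IsAbsMax (u t) x →
            ∀ (w₁ : EuclideanSpace ℝ (Fin 3) → EuclideanSpace ℝ (Fin 3)) (q₁ : EuclideanSpace ℝ (Fin 3) → ℝ)
              (w₂ : EuclideanSpace ℝ (Fin 3) → EuclideanSpace ℝ (Fin 3)) (q₂ : EuclideanSpace ℝ (Fin 3) → ℝ),
              IsHelmholtzPair (convect (u t) (u t)) w₁ q₁ → IsHelmholtzPair (f t) w₂ q₂ →
              ⟪u t x, timeDerivWithin (Ico 0 T) u t x⟫_ℝ = ν * ⟪u t x, Δ (u t) x⟫_ℝ + ⟪u t x, w₂ x⟫_ℝ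

/-- **Step 9c — p.5 d3–d4 from the u-dotted display**: IF `u·∂ₜu(x̃,t) = νu·Δu(x̃,t) + u·Pf(x̃,t)` and
`u·Δu(x̃,t) ⩽ 0` THEN every time derivative `D` of `s ↦ |u(x̃,s)|` at `t` satisfies `D ⩽ |Pf(x̃,t)|`.
(True: Cauchy–Schwarz.) [claim: Iotti2011NSLinfty, status: disputed] -/
def Step_9c : Prop :=
  ∀ ν : ℝ, 0 ≤ ν →
    ∀ (u₀ : EuclideanSpace ℝ (Fin 3) → EuclideanSpace ℝ (Fin 3))
      (f : ℝ → EuclideanSpace ℝ (Fin 3) → EuclideanSpace ℝ (Fin 3)), IsDatum u₀ → IsForce f →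
      ∀ T : ℝ, 0 < T →
        ∀ (u : ℝ → EuclideanSpace ℝ (Fin 3) → EuclideanSpace ℝ (Fin 3))
          (p : ℝ → EuclideanSpace ℝ (Fin 3) → ℝ), IsLocalSolution ν T u₀ f u p →
          ∀ t ∈ Ioo 0 T, ∀ x, IsAbsMax (u t) x →
            ∀ (w₂ : EuclideanSpace ℝ (Fin 3) → EuclideanSpace ℝ (Fin 3)) (q₂ : EuclideanSpace ℝ (Fin 3) → ℝ),
              IsHelmholtzPair (f t) w₂ q₂ →
              ⟪u t x, timeDerivWithin (Ico 0 T) u t x⟫_ℝ = ν * ⟪u t x, Δ (u t) x⟫_ℝ + ⟪u t x, w₂ x⟫_ℝ →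
              ⟪u t x, Δ (u t) x⟫_ℝ ≤ 0 →
              ∀ D : ℝ, HasDerivWithinAt (fun s => ‖u s x‖) D (Ico 0 T) t → D ≤ ‖w₂ x‖

/-! ### Kernel relations between the grains (PROVED) -/

/-- The convective term `u·∇u(t)` of a solution of the class is a smooth field (plumbing: `x ↦
Du(t)(x)[u(t)(x)]` with `u(t) ∈ C^∞`). [folklore] -/
private theorem contDiff_convect_of_sol {ν T : ℝ} {u₀ : EuclideanSpace ℝ (Fin 3) → EuclideanSpace ℝ (Fin 3)}
    {f u : ℝ → EuclideanSpace ℝ (Fin 3) → EuclideanSpace ℝ (Fin 3)} {p : ℝ → EuclideanSpace ℝ (Fin 3) → ℝ}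
    (hsol : IsLocalSolution ν T u₀ f u p) {t : ℝ} (ht : t ∈ Ico 0 T) :
    ContDiff ℝ ∞ (convect (u t) (u t)) := by
  have hu : ContDiff ℝ ∞ (u t) := hsol.isClassical.contDiff_velocity ht
  have h1 : ContDiff ℝ ∞ (fun x => fderiv ℝ (u t) x) := hu.fderiv_right (by norm_cast)
  have h : ContDiff ℝ ∞ (fun x => fderiv ℝ (u t) x (u t x)) := h1.clm_apply hu
  have heq : convect (u t) (u t) = fun x => fderiv ℝ (u t) x (u t x) := by
    funext x; rfl
  rw [heq]; exact h

/-- **Step 5 is the solution-grain instance of Step 5Abs** (the print's justification applies the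
pointwise reading of the decomposition to `v = u·∇u(t)`). [cite: Iotti2011NSLinfty, proof of Thm 3.1 p.4] -/
theorem step5_of_abs (h : Step_5Abs) : Step_5 := by
  intro ν _hν u₀ f _hu₀ _hf T _hT u p hsol t ht w₁ q₁ hpair x hx
  exact h (convect (u t) (u t)) w₁ q₁ (contDiff_convect_of_sol hsol ht) hpair x hx

/-- **Step 7 is the solution-grain instance of Step 7Abs** (the slice `u(·,t)` of a classical solution
is differentiable). [cite: Iotti2011NSLinfty, proof of Thm 3.1 p.4] -/
theorem step7_of_abs (h : Step_7Abs) : Step_7 := by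
  intro ν _hν u₀ f _hu₀ _hf T _hT u p hsol t ht x hx
  have hu : ContDiff ℝ ∞ (u t) := hsol.isClassical.contDiff_velocity ⟨ht.1.le, ht.2⟩
  exact h (u t) (hu.differentiable (by norm_cast)) x hx

/-- **The substituted equation of p.5 from Steps 4–7, as the paper derives it**: at an absolute maximum
point `x̃`, Step 7 gives `∇u(x̃,t) = 0`, hence `u·∇u(x̃,t) = 0` and (Step 6) `∇·(u·∇u)(x̃,t) = 0`, hence
(Step 5) `∇q₁(x̃,t) = 0`, hence (Step 4) `∇p(x̃,t) = ∇q₂(x̃,t)`; substituting `f = Pf + ∇q₂` into (1.1)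
at `(x̃,t)` leaves `∂ₜu = νΔu + Pf`. [cite: Iotti2011NSLinfty, proof of Thm 3.1 p.4–5] -/
theorem display_of_steps (h4 : Step_4) (h5 : Step_5) (h6 : Step_6) (h7 : Step_7) : Display_p5 := by
  intro ν hν u₀ f hu₀ hf T hT u p hsol t ht x hx w₁ q₁ w₂ q₂ hp₁ hp₂
  have ht' : t ∈ Ico 0 T := ⟨ht.1.le, ht.2⟩
  have hD : fderiv ℝ (u t) x = 0 := h7 ν hν u₀ f hu₀ hf T hT u p hsol t ht x hx
  have hdiv : VectorCalculus.divergence (convect (u t) (u t)) x = 0 :=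
    h6 ν hν u₀ f hu₀ hf T hT u p hsol t ht' x hD
  have hq₁ : gradient q₁ x = 0 := (h5 ν hν u₀ f hu₀ hf T hT u p hsol t ht' w₁ q₁ hp₁ x hdiv).1
  have hgp : gradient (p t) x = gradient q₂ x - gradient q₁ x :=
    h4 ν hν u₀ f hu₀ hf T hT u p hsol t ht' w₁ q₁ w₂ q₂ hp₁ hp₂ x
  have hconv : convect (u t) (u t) x = 0 := by
    rw [convect_apply, hD]
    simp
  have hm := hsol.isClassical.momentum t ht' x
  rw [hconv, add_zero, hgp, hq₁, sub_zero, hp₂.decomp x] at hm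
  rw [hm]
  abel

/-- **Theorem 3.1 from Steps 3–10, as the proof composes them** (p.3–7): the Helmholtz pair of `u·∇u(s)`
exists (Step 3), the substituted equation holds at every absolute maximum point (Steps 4–7), `u·Δu ⩽ 0`
there (Steps 7, 8), hence the pointwise bound `∂|u(x̃,s)|/∂t ⩽ |Pf(x̃,s)|` (Step 9), hence (3.1) by the
envelope argument (Step 10). [cite: Iotti2011NSLinfty, proof of Thm 3.1 p.3–7] -/
theorem theorem31_of_steps (h3 : Step_3) (h4 : Step_4) (h5 : Step_5) (h6 : Step_6) (h7 : Step_7)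
    (h8 : Step_8) (h9 : Step_9) (h10 : Step_10) : Theorem31 := by
  intro ν hν u₀ f hu₀ hf T hT u p hsol w₂ q₂ hfam t ht
  have hdisp : Display_p5 := display_of_steps h4 h5 h6 h7
  obtain ⟨w₁, q₁, _w₂', _q₂', hfam'⟩ := h3 ν hν u₀ f hu₀ hf T hT u p hsol
  refine h10 ν hν u₀ f hu₀ hf T hT u p hsol w₂ q₂ hfam ?_ t ht
  intro s hs x hx D hD
  have hs' : s ∈ Ico 0 T := ⟨hs.1.le, hs.2⟩
  have hgrad : fderiv ℝ (u s) x = 0 := h7 ν hν u₀ f hu₀ hf T hT u p hsol s hs x hx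
  have heq : timeDerivWithin (Ico 0 T) u s x = ν • Δ (u s) x + w₂ s x :=
    hdisp ν hν u₀ f hu₀ hf T hT u p hsol s hs x hx (w₁ s) (q₁ s) (w₂ s) (q₂ s) (hfam' s hs').1 (hfam s hs')
  have hsign : ⟪u s x, Δ (u s) x⟫_ℝ ≤ 0 := by
    obtain ⟨hid, hlap⟩ := h8 ν hν u₀ f hu₀ hf T hT u p hsol s hs x hx hgrad
    rw [hid]
    linarith
  exact h9 ν hν u₀ f hu₀ hf T hT u p hsol s hs x hx (w₂ s) (q₂ s) (hfam s hs') heq hsign D hD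

/-- **Theorem 3.2 = the claim, from the paper's steps** (p.7): Step 1 gives a global solution or a maximal
finite `T*` with a solution on `[0,T*)`; in the latter case Theorem 3.1 (Steps 3–10) and its integration
(Step 11) bound the velocity on `[0,T*)`, while Theorem 2.3 (Step 2) makes it unbounded — «So, for the
theorem 2.3 it must be T* = ∞». [cite: Iotti2011NSLinfty, proof of Thm 3.2 p.7] -/
theorem claim_of_steps (h1 : Step_1) (h2 : Step_2) (h3 : Step_3) (h4 : Step_4) (h5 : Step_5)
    (h6 : Step_6) (h7 : Step_7) (h8 : Step_8) (h9 : Step_9) (h10 : Step_10) (h11 : Step_11) :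
    ClaimedTheorem := by
  intro ν hν u₀ f hu₀ hf
  rcases h1 ν hν u₀ f hu₀ hf with hglob | ⟨T, hT, u, p, hsol, hmax⟩
  · exact hglob
  · exfalso
    obtain ⟨_w₁, _q₁, w₂, q₂, hfam⟩ := h3 ν hν u₀ f hu₀ hf T hT u p hsol
    have hfam₂ : ∀ s ∈ Ico 0 T, IsHelmholtzPair (f s) (w₂ s) (q₂ s) := fun s hs => (hfam s hs).2
    have h31 := theorem31_of_steps h3 h4 h5 h6 h7 h8 h9 h10 ν hν u₀ f hu₀ hf T hT u p hsol w₂ q₂ hfam₂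
    obtain ⟨M, hM⟩ := h11 ν hν u₀ f hu₀ hf T hT u p hsol w₂ q₂ hfam₂ h31
    obtain ⟨t, ht, x, hx⟩ := h2 ν hν u₀ f hu₀ hf T hT u p hsol hmax M
    exact (lt_irrefl M) (hx.trans_le (hM t ht x))

/-- The same composition through the sentence-grain companions of Steps 5 and 7.
[cite: Iotti2011NSLinfty, proof of Thm 3.1 p.4] -/
theorem claim_of_steps_abs (h1 : Step_1) (h2 : Step_2) (h3 : Step_3) (h4 : Step_4) (h5 : Step_5Abs)
    (h6 : Step_6) (h7 : Step_7Abs) (h8 : Step_8) (h9 : Step_9) (h10 : Step_10) (h11 : Step_11) :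
    ClaimedTheorem :=
  claim_of_steps h1 h2 h3 h4 (step5_of_abs h5) h6 (step7_of_abs h7) h8 h9 h10 h11

/-- **The u-dotted display of p.5 from Steps 4, 5min, 7c** (the charitable chain): dot (1.1) at
`(x̃,t)` with `u(x̃,t)`; the convective term drops by `∇|u|²(x̃,t) = 0` (Step 7c), the pressure term is
`u·∇q₂ − u·∇q₁ = u·∇q₂` (Steps 4, 5min), and `u·f = u·Pf + u·∇q₂`. [cite: Iotti2011NSLinfty, proof of Thm 3.1 p.4–5] -/
theorem displayDot_of_steps (h4 : Step_4) (h5 : Step_5min) (h7 : Step_7c) : Display_p5_dot := by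
  intro ν hν u₀ f hu₀ hf T hT u p hsol t ht x hx w₁ q₁ w₂ q₂ hp₁ hp₂
  have ht' : t ∈ Ico 0 T := ⟨ht.1.le, ht.2⟩
  have hconv : ⟪u t x, convect (u t) (u t) x⟫_ℝ = 0 := by
    rw [convect_apply]
    exact h7 ν hν u₀ f hu₀ hf T hT u p hsol t ht x hx (u t x)
  have hq₁ : ⟪u t x, gradient q₁ x⟫_ℝ = 0 := h5 ν hν u₀ f hu₀ hf T hT u p hsol t ht x hx w₁ q₁ hp₁
  have hgp : gradient (p t) x = gradient q₂ x - gradient q₁ x :=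
    h4 ν hν u₀ f hu₀ hf T hT u p hsol t ht' w₁ q₁ w₂ q₂ hp₁ hp₂ x
  have hm := hsol.isClassical.momentum t ht' x
  have hm' : timeDerivWithin (Ico 0 T) u t x =
      ν • Δ (u t) x - (gradient q₂ x - gradient q₁ x) + (w₂ x + gradient q₂ x) - convect (u t) (u t) x := by
    rw [← hgp, ← hp₂.decomp x, ← hm]
    abel
  rw [hm', inner_sub_right, inner_add_right, inner_sub_right, inner_smul_right, inner_sub_right,
    inner_add_right, hconv, hq₁]
  ring

/-- **Theorem 3.1 from the charitable chain**: Steps 3, 4, 5min, 7c, 8c, 9c, 10 compose to (3.1) — every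
hypothesis other than `Step_5min` (pressure) and `Step_10` (the envelope derivative) is classical in the
class. [cite: Iotti2011NSLinfty, proof of Thm 3.1 p.3–7] -/
theorem theorem31_of_steps_charitable (h3 : Step_3) (h4 : Step_4) (h5 : Step_5min) (h7 : Step_7c)
    (h8 : Step_8c) (h9 : Step_9c) (h10 : Step_10) : Theorem31 := by
  intro ν hν u₀ f hu₀ hf T hT u p hsol w₂ q₂ hfam t ht
  have hdisp : Display_p5_dot := displayDot_of_steps h4 h5 h7
  obtain ⟨w₁, q₁, _w₂', _q₂', hfam'⟩ := h3 ν hν u₀ f hu₀ hf T hT u p hsol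
  refine h10 ν hν u₀ f hu₀ hf T hT u p hsol w₂ q₂ hfam ?_ t ht
  intro s hs x hx D hD
  have hs' : s ∈ Ico 0 T := ⟨hs.1.le, hs.2⟩
  have heq := hdisp ν hν u₀ f hu₀ hf T hT u p hsol s hs x hx (w₁ s) (q₁ s) (w₂ s) (q₂ s) (hfam' s hs').1
    (hfam s hs')
  exact h9 ν hν u₀ f hu₀ hf T hT u p hsol s hs x hx (w₂ s) (q₂ s) (hfam s hs') heq
    (h8 ν hν u₀ f hu₀ hf T hT u p hsol s hs x hx) D hD

/-- **The claim from the charitable chain** (Steps 1, 2, 3, 4, 5min, 7c, 8c, 9c, 10, 11).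
[cite: Iotti2011NSLinfty, proof of Thm 3.2 p.7] -/
theorem claim_of_steps_charitable (h1 : Step_1) (h2 : Step_2) (h3 : Step_3) (h4 : Step_4)
    (h5 : Step_5min) (h7 : Step_7c) (h8 : Step_8c) (h9 : Step_9c) (h10 : Step_10) (h11 : Step_11) :
    ClaimedTheorem := by
  intro ν hν u₀ f hu₀ hf
  rcases h1 ν hν u₀ f hu₀ hf with hglob | ⟨T, hT, u, p, hsol, hmax⟩
  · exact hglob
  · exfalso
    obtain ⟨_w₁, _q₁, w₂, q₂, hfam⟩ := h3 ν hν u₀ f hu₀ hf T hT u p hsol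
    have hfam₂ : ∀ s ∈ Ico 0 T, IsHelmholtzPair (f s) (w₂ s) (q₂ s) := fun s hs => (hfam s hs).2
    have h31 := theorem31_of_steps_charitable h3 h4 h5 h7 h8 h9 h10 ν hν u₀ f hu₀ hf T hT u p hsol w₂ q₂
      hfam₂
    obtain ⟨M, hM⟩ := h11 ν hν u₀ f hu₀ hf T hT u p hsol w₂ q₂ hfam₂ h31
    obtain ⟨t, ht, x, hx⟩ := h2 ν hν u₀ f hu₀ hf T hT u p hsol hmax M
    exact (lt_irrefl M) (hx.trans_le (hM t ht x))

/-! ### Clay link -/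

/-- The zero force is a force of class (1.3) (plumbing; `ClayVariants`). [folklore] -/
private theorem isForce_zero : IsForce (0 : ℝ → EuclideanSpace ℝ (Fin 3) → EuclideanSpace ℝ (Fin 3)) :=
  ⟨ClayVariants.isSmoothOnHalfSpace_zero, ClayVariants.hasRapidSpaceTimeDecay_zero⟩

/-- **The claim implies Clay (A)** (`ClayVariants.clayR3.Regularity`, token for token the summit body):
its `ν > 0`, `f ≡ 0` instance. A Clay datum (smooth, divergence free, (4)) is a datum (1.2) verbatim; the
global solution of the class is smooth on `ℝ³ × [0,∞)` with `u(0) = u₀` (`isNavierStokesSolution_and_smooth_iff`)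
and has bounded energy (7) with `C = ∫|u₀|²` by the energy inequality in the Beale–Kato–Majda class
(`IsClassicalNSSolutionOn.bkm_energy_le`) — the argument of C28b `Iotti2025.clay_of_claimedGlobalNS`.
[cite: FeffermanClay2006, statement (A), CMI offprint p. 2] -/
theorem clay_of_claimed (h : ClaimedTheorem) : ClayVariants.clayR3.Regularity := by
  intro ν hν u₀ hu₀ hdiv hdecay
  have hdat : IsDatum u₀ := ⟨hu₀, fun x => hdiv x, hdecay⟩
  obtain ⟨u, p, hsol⟩ := h ν hν.le u₀ 0 hdat isForce_zero
  obtain ⟨hns, hsu, hsp⟩ :=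
    (isNavierStokesSolution_and_smooth_iff (ν := ν) (f := 0) (u₀ := u₀) (u := u) (p := p)).2
      ⟨hsol.isClassical, hsol.initial⟩
  refine ⟨u, p, hsu, hsp, hns, ?_⟩
  show HasBoundedEnergy u
  have hL2 : ∀ n : ℕ, ∀ T : ℝ, ∀ τ ∈ Icc (0:ℝ) T, ∫⁻ x, ‖iteratedFDeriv ℝ n (u τ) x‖ₑ ^ 2 < ⊤ := by
    intro n T τ hτ
    obtain ⟨C, hC⟩ := hsol.sobolev T n
    exact (hC τ hτ).trans_lt ENNReal.coe_lt_top
  have key : ∀ S : ℝ, 0 < S → ∀ τ ∈ Icc (0:ℝ) S,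
      ∫⁻ x, ‖u τ x‖ₑ ^ 2 = ENNReal.ofReal (∫ x, ‖u τ x‖ ^ 2) := by
    intro S hS τ hτ
    have hcl : IsClassicalNSSolutionOn (Icc 0 S) ν 0 u p :=
      hsol.isClassical.mono Icc_subset_Ici_self (uniqueDiffOn_Icc hS)
    have hfin0 := hL2 0 S τ hτ
    have heq : (fun x => ‖iteratedFDeriv ℝ 0 (u τ) x‖ₑ ^ 2) = fun x => ‖u τ x‖ₑ ^ 2 := by
      funext x
      rw [← ofReal_norm, norm_iteratedFDeriv_zero, ofReal_norm]
    have hfin : ∫⁻ x, ‖u τ x‖ₑ ^ 2 < ⊤ := by rwa [heq] at hfin0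
    have hint : Integrable (fun x => ‖u τ x‖ ^ 2) :=
      integrable_sq_norm_of_lintegral_lt_top (hcl.contDiff_velocity hτ).continuous hfin
    rw [ofReal_integral_eq_lintegral_ofReal hint (Eventually.of_forall fun x => sq_nonneg _)]
    refine lintegral_congr fun x => ?_
    rw [← ofReal_norm, ENNReal.ofReal_pow (norm_nonneg _)]
  refine ⟨∫⁻ x, ‖u₀ x‖ₑ ^ 2, ?_, fun t ht => ?_⟩
  · have h0 := hL2 0 1 0 ⟨le_rfl, zero_le_one⟩
    have heq : (fun x => ‖iteratedFDeriv ℝ 0 (u 0) x‖ₑ ^ 2) = fun x => ‖u₀ x‖ₑ ^ 2 := by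
      funext x
      rw [← ofReal_norm, norm_iteratedFDeriv_zero, ofReal_norm, hsol.initial]
    rwa [heq] at h0
  · have hT : (0:ℝ) < t + 1 := by linarith
    have hcl : IsClassicalNSSolutionOn (Icc 0 (t + 1)) ν 0 u p :=
      hsol.isClassical.mono Icc_subset_Ici_self (uniqueDiffOn_Icc hT)
    have hE : ∫ x, ‖u t x‖ ^ 2 ≤ ∫ x, ‖u 0 x‖ ^ 2 :=
      hcl.bkm_energy_le hν.le hT (hsol.sobolev (t + 1)) ⟨ht, by linarith⟩
    rw [key (t + 1) hT t ⟨ht, by linarith⟩, ← hsol.initial, key (t + 1) hT 0 ⟨le_rfl, hT.le⟩]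
    exact ENNReal.ofReal_le_ofReal hE

/-! ### Kernel-true steps of the charitable chain (rev 2; PROVED, nothing new asserted)

With these, `claim_of_steps_charitable` visibly hangs on `Step_1`–`Step_4`, `Step_8c`, `Step_10`, `Step_11`
(classical in the class) and on `Step_5min` (the pressure term) — the kernel confirms that the first-order
condition the print needed at the maximum point (Step 7c) and the Cauchy–Schwarz passage of p.5 (Steps 9,
9c) are true. -/

/-- **Step 7c holds (Fermat at the speed maximum)**: at an absolute maximum point `x̃` of `|u(·,t)|` the
derivative of `y ↦ |u(y,t)|²` vanishes, i.e. `u(x̃,t)·(∇u(x̃,t)h) = 0` for every `h`.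
[cite: Iotti2011NSLinfty, proof of Thm 3.1 p.4 d4 (charitable reading) and p.6 d3] -/
theorem step7c_holds : Step_7c := by
  intro ν _hν u₀ f _hu₀ _hf T _hT u p hsol t ht x hx h
  have hu : ContDiff ℝ ∞ (u t) := hsol.isClassical.contDiff_velocity ⟨ht.1.le, ht.2⟩
  have hd : HasFDerivAt (u t) (fderiv ℝ (u t) x) x :=
    ((hu.differentiable (by norm_cast)) x).hasFDerivAt
  have hg := hd.norm_sq
  have hmax : IsMaxOn (‖u t ·‖ ^ 2) Set.univ x := by
    intro y _
    show ‖u t y‖ ^ 2 ≤ ‖u t x‖ ^ 2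
    nlinarith [hx y, norm_nonneg (u t y), norm_nonneg (u t x)]
  have hzero := (hmax.isLocalMax Filter.univ_mem).hasFDerivAt_eq_zero hg
  have happ := congrArg (fun L : EuclideanSpace ℝ (Fin 3) →L[ℝ] ℝ => L h) hzero
  simp only [FunLike.coe_smul, Pi.smul_apply, ContinuousLinearMap.comp_apply,
    innerSL_apply_apply] at happ
  have h2 : (2 : ℝ) * ⟪u t x, fderiv ℝ (u t) x h⟫_ℝ = 0 := by simpa using happ
  linarith

/-- Plumbing for Steps 9/9c: if `γ` has derivative `γ'` at `t`, `s ↦ |γ(s)|` has derivative `D` at `t`, and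
`γ(t)·γ' ⩽ |γ(t)|·B` with `B ⩾ 0`, then `D ⩽ B` (at `γ(t) = 0` the norm has a local minimum, so `D = 0`;
otherwise `|γ| D = γ·γ'` by uniqueness of the derivative of `|γ|²`). [folklore] -/
private theorem deriv_norm_le {γ : ℝ → EuclideanSpace ℝ (Fin 3)} {γ' : EuclideanSpace ℝ (Fin 3)}
    {t D B : ℝ} (hγ : HasDerivAt γ γ' t) (hN : HasDerivAt (fun s => ‖γ s‖) D t)
    (hb : ⟪γ t, γ'⟫_ℝ ≤ ‖γ t‖ * B) (hB : 0 ≤ B) : D ≤ B := by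
  by_cases h0 : γ t = 0
  · have hmin : IsLocalMin (fun s => ‖γ s‖) t :=
      Filter.Eventually.of_forall fun s => by simp [h0]
    have hD : D = 0 := hmin.hasDerivAt_eq_zero hN
    rw [hD]; exact hB
  · have hpos : 0 < ‖γ t‖ := norm_pos_iff.mpr h0
    have h1 : HasDerivAt (fun s => ‖γ s‖ * ‖γ s‖) (D * ‖γ t‖ + ‖γ t‖ * D) t := hN.mul hN
    have h2 : HasDerivAt (fun s => ⟪γ s, γ s⟫_ℝ) (⟪γ t, γ'⟫_ℝ + ⟪γ', γ t⟫_ℝ) t := hγ.inner ℝ hγ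
    have hfun : (fun s => ‖γ s‖ * ‖γ s‖) = fun s => ⟪γ s, γ s⟫_ℝ := by
      funext s; rw [real_inner_self_eq_norm_mul_norm]
    rw [hfun] at h1
    have heq : D * ‖γ t‖ + ‖γ t‖ * D = ⟪γ t, γ'⟫_ℝ + ⟪γ', γ t⟫_ℝ := h1.unique h2
    rw [real_inner_comm (γ t) γ'] at heq
    have hD : ‖γ t‖ * D = ⟪γ t, γ'⟫_ℝ := by linarith
    have hle : ‖γ t‖ * D ≤ ‖γ t‖ * B := by rw [hD]; exact hb
    exact le_of_mul_le_mul_left hle hpos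

/-- The time line `s ↦ u(x,s)` of a solution of the class has derivative `∂ₜu(x,t)` (the one-sided
`timeDerivWithin (Ico 0 T)`) at every interior `t ∈ (0,T)`. [folklore] -/
private theorem hasDerivAt_timeLine {ν T : ℝ} {u₀ : EuclideanSpace ℝ (Fin 3) → EuclideanSpace ℝ (Fin 3)}
    {f u : ℝ → EuclideanSpace ℝ (Fin 3) → EuclideanSpace ℝ (Fin 3)} {p : ℝ → EuclideanSpace ℝ (Fin 3) → ℝ}
    (hsol : IsLocalSolution ν T u₀ f u p) {t : ℝ} (ht : t ∈ Ioo 0 T) (x : EuclideanSpace ℝ (Fin 3)) :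
    HasDerivAt (fun s => u s x) (timeDerivWithin (Ico 0 T) u t x) t := by
  have hw : DifferentiableWithinAt ℝ (fun s => u s x) (Ico 0 T) t :=
    hsol.isClassical.smooth_velocity.differentiableWithinAt_time ⟨ht.1.le, ht.2⟩ x
  have h := hw.hasDerivWithinAt
  rw [← timeDerivWithin_apply] at h
  exact h.hasDerivAt (Ico_mem_nhds ht.1 ht.2)

/-- **Step 9c holds** (p.5 d3–d4 from the u-dotted display: Cauchy–Schwarz). [cite: Iotti2011NSLinfty, proof of Thm 3.1 p.5 d2–d4] -/
theorem step9c_holds : Step_9c := by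
  intro ν hν u₀ f hu₀ hf T hT u p hsol t ht x _hx w₂ q₂ _hp₂ hdisp hsign D hD
  have hγ := hasDerivAt_timeLine hsol ht x
  have hN : HasDerivAt (fun s => ‖u s x‖) D t := hD.hasDerivAt (Ico_mem_nhds ht.1 ht.2)
  refine deriv_norm_le hγ hN ?_ (norm_nonneg (w₂ x))
  rw [hdisp]
  have h1 : ν * ⟪u t x, Δ (u t) x⟫_ℝ ≤ 0 := mul_nonpos_of_nonneg_of_nonpos hν hsign
  have h2 : ⟪u t x, w₂ x⟫_ℝ ≤ ‖u t x‖ * ‖w₂ x‖ := real_inner_le_norm _ _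
  linarith

/-- **Step 9 holds** (p.5 d2–d4 from the vector display: dot with `u(x̃,t)` and apply Cauchy–Schwarz).
[cite: Iotti2011NSLinfty, proof of Thm 3.1 p.5 d2–d4] -/
theorem step9_holds : Step_9 := by
  intro ν hν u₀ f hu₀ hf T hT u p hsol t ht x _hx w₂ q₂ _hp₂ hdisp hsign D hD
  have hγ := hasDerivAt_timeLine hsol ht x
  have hN : HasDerivAt (fun s => ‖u s x‖) D t := hD.hasDerivAt (Ico_mem_nhds ht.1 ht.2)
  refine deriv_norm_le hγ hN ?_ (norm_nonneg (w₂ x))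
  rw [hdisp, inner_add_right, inner_smul_right]
  have h1 : ν * ⟪u t x, Δ (u t) x⟫_ℝ ≤ 0 := mul_nonpos_of_nonneg_of_nonpos hν hsign
  have h2 : ⟪u t x, w₂ x⟫_ℝ ≤ ‖u t x‖ * ‖w₂ x‖ := real_inner_le_norm _ _
  linarith

/-- **The charitable composition with its kernel-true steps discharged**: the claim follows from Steps 1–4,
5min, 8c, 10, 11 alone. [cite: Iotti2011NSLinfty, proof of Thm 3.1–3.2 p.3–7] -/
theorem claim_of_steps_reduced (h1 : Step_1) (h2 : Step_2) (h3 : Step_3) (h4 : Step_4) (h5 : Step_5min)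
    (h8 : Step_8c) (h10 : Step_10) (h11 : Step_11) : ClaimedTheorem :=
  claim_of_steps_charitable h1 h2 h3 h4 h5 step7c_holds h8 step9c_holds h10 h11

/-! ### Step 8c discharged (rev 3; PROVED, nothing new asserted): `u·Δu ≤ 0` at the speed maximum -/

namespace Step8cProof

/-- First-order condition at a global maximum `x₀` of `|V|²`: `⟪V(x₀), DV(x₀) w⟫ = 0` (the same
computation as `step7c_holds`; this lemma and the two below are copied from the tree's C09 `Liu2025`
max-principle block, where they are private). [folklore] -/
private theorem inner_fderiv_eq_zero_of_isMax {V : (EuclideanSpace ℝ (Fin 3)) → (EuclideanSpace ℝ (Fin 3))} (hV : ContDiff ℝ ∞ V) {x₀ : (EuclideanSpace ℝ (Fin 3))}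
    (hmax : ∀ x, ‖V x‖ ^ 2 ≤ ‖V x₀‖ ^ 2) (w : (EuclideanSpace ℝ (Fin 3))) : ⟪V x₀, fderiv ℝ V x₀ w⟫_ℝ = 0 := by
  have hloc : IsLocalMax (fun x => ‖V x‖ ^ 2) x₀ := Filter.Eventually.of_forall hmax
  have hd := (hV.differentiable (by simp) x₀).hasFDerivAt.norm_sq
  have h0 := hloc.hasFDerivAt_eq_zero hd
  have h1 := congrArg (fun L : (EuclideanSpace ℝ (Fin 3)) →L[ℝ] ℝ => L w) h0
  simpa using h1

/-- Second-order condition at a global maximum `x₀` of `|V|²` along a direction `e`: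
`⟪V(x₀), ∂ₑ∂ₑV(x₀)⟫ ≤ 0` (from `∂ₑ∂ₑ|V|² = 2|∂ₑV|² + 2⟪V, ∂ₑ∂ₑV⟫ ≤ 0` at a maximum of the line
restriction). [folklore] -/
private theorem inner_fderiv_fderiv_nonpos_of_isMax {V : (EuclideanSpace ℝ (Fin 3)) → (EuclideanSpace ℝ (Fin 3))} (hV : ContDiff ℝ ∞ V) {x₀ : (EuclideanSpace ℝ (Fin 3))}
    (hmax : ∀ x, ‖V x‖ ^ 2 ≤ ‖V x₀‖ ^ 2) (e : (EuclideanSpace ℝ (Fin 3))) :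
    ⟪V x₀, fderiv ℝ (fun y => fderiv ℝ V y e) x₀ e⟫_ℝ ≤ 0 := by
  have hV2 : ContDiff ℝ 2 V := contDiff_infty.mp hV 2
  -- `W = ∂ₑ V`
  set W : (EuclideanSpace ℝ (Fin 3)) → (EuclideanSpace ℝ (Fin 3)) := fun y => fderiv ℝ V y e with hW
  have hVd : ∀ y, HasFDerivAt V (fderiv ℝ V y) y := fun y =>
    (hV2.differentiable (by simp) y).hasFDerivAt
  have hW1 : ContDiff ℝ 1 W := (hV2.fderiv_right (m := 1) le_rfl).clm_apply contDiff_const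
  have hWd : ∀ y, HasFDerivAt W (fderiv ℝ W y) y := fun y =>
    (hW1.differentiable one_ne_zero y).hasFDerivAt
  -- the line `p s = x₀ + s e`
  let p : ℝ → (EuclideanSpace ℝ (Fin 3)) := fun s => x₀ + s • e
  have hp0 : p 0 = x₀ := by simp [p]
  have hpd : ∀ s, HasDerivAt p e s := fun s => by
    show HasDerivAt (fun s : ℝ => x₀ + s • e) e s
    simpa using ((hasDerivAt_id s).smul_const e).const_add x₀
  have hVp : ∀ s, HasDerivAt (fun s => V (p s)) (W (p s)) s := fun s => by
    have := (hVd (p s)).comp_hasDerivAt s (hpd s)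
    simpa [hW, Function.comp_def] using this
  have hWp : ∀ s, HasDerivAt (fun s => W (p s)) (fderiv ℝ W (p s) e) s := fun s => by
    have := (hWd (p s)).comp_hasDerivAt s (hpd s)
    simpa [Function.comp_def] using this
  -- `ℓ(s) = |V(p s)|²` and its first two derivatives
  set ℓ : ℝ → ℝ := fun s => ⟪V (p s), V (p s)⟫_ℝ with hℓ
  have hℓd : ∀ s, HasDerivAt ℓ (2 * ⟪V (p s), W (p s)⟫_ℝ) s := fun s => by
    refine ((hVp s).inner ℝ (hVp s)).congr_deriv ?_
    rw [real_inner_comm (W (p s)), two_mul]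
  have hderiv : deriv ℓ = fun s => 2 * ⟪V (p s), W (p s)⟫_ℝ := funext fun s => (hℓd s).deriv
  have hℓdd : ∀ s, HasDerivAt (fun s => 2 * ⟪V (p s), W (p s)⟫_ℝ)
      (2 * (⟪V (p s), fderiv ℝ W (p s) e⟫_ℝ + ⟪W (p s), W (p s)⟫_ℝ)) s := fun s =>
    ((hVp s).inner ℝ (hWp s)).const_mul 2
  have hderiv2 : deriv (deriv ℓ) 0 = 2 * (⟪V x₀, fderiv ℝ W x₀ e⟫_ℝ + ⟪W x₀, W x₀⟫_ℝ) := by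
    rw [hderiv, (hℓdd 0).deriv, hp0]
  have hderiv1 : deriv ℓ 0 = 0 := by
    rw [hderiv]
    simp only [hp0, hW]
    rw [inner_fderiv_eq_zero_of_isMax hV hmax e, mul_zero]
  -- `ℓ` has a (global, hence local) maximum at `0`
  have hℓmax : IsLocalMax ℓ 0 := Filter.Eventually.of_forall fun s => by
    simp only [hℓ, real_inner_self_eq_norm_sq, hp0]
    exact hmax _
  -- if the second derivative were positive, `0` would also be a local minimum, so `ℓ` would be
  -- locally constant and its second derivative would vanish
  by_contra hcon
  push Not at hcon
  have hpos : deriv (deriv ℓ) 0 > 0 := by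
    rw [hderiv2]
    have : 0 ≤ ⟪W x₀, W x₀⟫_ℝ := real_inner_self_nonneg
    linarith
  have hℓmin : IsLocalMin ℓ 0 := isLocalMin_of_deriv_deriv_pos hpos hderiv1 (hℓd 0).continuousAt
  have hconst : ∀ᶠ s in 𝓝 (0 : ℝ), ℓ s = ℓ 0 :=
    (hℓmin.and hℓmax).mono fun s hs => le_antisymm hs.2 hs.1
  have hd0 : deriv ℓ =ᶠ[𝓝 (0 : ℝ)] fun _ => (0 : ℝ) := by
    filter_upwards [hconst.eventually_nhds] with s hs
    have h1 : ℓ =ᶠ[𝓝 s] fun _ => ℓ 0 := hs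
    rw [h1.deriv_eq, deriv_const]
  have : deriv (deriv ℓ) 0 = 0 := by rw [hd0.deriv_eq, deriv_const]
  linarith

/-- At a global maximum `x₀` of `|V|²`: `⟪V(x₀), ΔV(x₀)⟫ ≤ 0` (sum of the directional second-order
conditions over an orthonormal basis, `FluidPDE.laplacian_eq_sum_fderiv_fderiv`). [folklore] -/
private theorem inner_laplacian_nonpos_of_isMax {V : (EuclideanSpace ℝ (Fin 3)) → (EuclideanSpace ℝ (Fin 3))} (hV : ContDiff ℝ ∞ V) {x₀ : (EuclideanSpace ℝ (Fin 3))}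
    (hmax : ∀ x, ‖V x‖ ^ 2 ≤ ‖V x₀‖ ^ 2) : ⟪V x₀, (Δ V) x₀⟫_ℝ ≤ 0 := by
  have hV2 : ContDiff ℝ 2 V := contDiff_infty.mp hV 2
  rw [laplacian_eq_sum_fderiv_fderiv (stdOrthonormalBasis ℝ (EuclideanSpace ℝ (Fin 3))) hV2 x₀, inner_sum]
  exact Finset.sum_nonpos fun i _ => inner_fderiv_fderiv_nonpos_of_isMax hV hmax _

end Step8cProof

open Step8cProof in
/-- **Step 8c holds** (p.4 d10, charitable reading): at an absolute maximum point `x̃` of `|u(·,t)|`,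
`u(x̃,t)·Δu(x̃,t) ≤ 0` — WITHOUT `∇u(x̃,t) = 0`: along every line through `x̃` the function `|u|²` has a
maximum, so `∂ₑ∂ₑ|u|² = 2|∂ₑu|² + 2u·∂ₑ∂ₑu ≤ 0`, and summing over an orthonormal basis `u·Δu ≤ −|∇u|² ≤ 0`
(`u(·,t) ∈ C^∞` from the class). In-file discharge (D-0026, debt pass typist-4 g4 on the chair's GO
2026-08-27T07:25:44Z); the row's verdict (#82 C28: token `Step_7Abs`) is untouched.
[cite: Iotti2011NSLinfty, proof of Thm 3.1 p.4 d10 (charitable reading)] -/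
theorem step8c_holds : Step_8c := by
  intro ν _hν u₀ f _hu₀ _hf T _hT u p hsol t ht x hx
  have hu : ContDiff ℝ ∞ (u t) := hsol.isClassical.contDiff_velocity ⟨ht.1.le, ht.2⟩
  have hmax : ∀ y, ‖u t y‖ ^ 2 ≤ ‖u t x‖ ^ 2 := fun y =>
    pow_le_pow_left₀ (norm_nonneg _) (hx y) 2
  exact inner_laplacian_nonpos_of_isMax hu hmax

/-! ### Step 6 holds (p.4 d3) — APPEND-ONLY D-0026 discharge (cell ns-claims, census-1 g9, 2026-08-27)

At a point `x` where the full gradient `Du(t)(x)` vanishes, `∇·((u·∇)u)(t,x) = 0`: the tree's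
`Literature.Analysis.FluidPDE.divergence_convect_self_eq` (LerayProfileCalculus, via the `Iotti2025`
import) gives `∇·((U·∇)U) = tr (DU ∘ DU)` for every `C²` divergence-free field — the printed identity
`Σ_{j,k} ∂_ju_k ∂_ku_j = ∇·(u·∇u)` (valid because `∇·u ≡ 0` kills the term `u·∇(∇·u)`) — and
`DU(x) = 0` makes the trace vanish. -/

/-- **Step 6 holds** (p.4 d3 «∇u = 0 ⇒ 0 = Σ_{j,k} ∂_ju_k ∂_ku_j = ∇·(u·∇u)»): at a point where the full
gradient of `u(t)` vanishes the divergence of `u·∇u(t)` vanishes, for every solution of the class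
(smooth slices, `∇·u(t) ≡ 0`). [cite: Iotti2011NSLinfty, p.4 d3] -/
theorem step6_holds : Step_6 := by
  intro ν _hν u₀ f _hu₀ _hf T _hT u p hsol t ht x hx
  have hcl := hsol.isClassical
  rw [divergence_convect_self_eq ((hcl.contDiff_velocity ht).of_le (by norm_cast)) (hcl.divFree t ht) x,
    hx]
  simp

/-! ### Step 8 holds (p.4 d5–d10, AS PRINTED) — APPEND-ONLY D-0026 discharge (cell ns-claims, typist-2 g5, 2026-08-27)

At an absolute maximum point `x̃` of `|u(·,t)|` at which the full gradient `Du(t)(x̃)` vanishes (the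
antecedent the print takes from Step 7): the tree identity `Δ⟪U,U⟫ = 2⟪ΔU,U⟫ + 2|DU|²_F`
(`Literature.Analysis.FluidPDE.laplacian_inner_self_eq`, Tsai 1998 proof of Lemma 3.1) loses its Frobenius
term, giving the printed `u·Δu = ½Δ|u|²`; and `⟪u(x̃,t), Δu(x̃,t)⟫ ≤ 0` at a maximum of `|u|²` (the in-file
second-order condition `inner_laplacian_nonpos_of_isMax` of the Step 8c pass) then gives `Δ|u|² ≤ 0` there.
Sibling of `step8c_holds` (the charitable reading without `∇u(x̃,t) = 0`); the row's verdict (#82 C28: token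
`Step_7Abs`) is untouched. -/

open Step8cProof in
/-- **Step 8 holds** (p.4 d5–d10 as printed): at an absolute maximum point `x̃` of `|u(·,t)|` where
`∇u(x̃,t) = 0`, `u(x̃,t)·Δu(x̃,t) = ½Δ|u(x̃,t)|²` and `Δ|u(x̃,t)|² ≤ 0` — from `Δ|U|² = 2U·ΔU + 2|∇U|²`
(Frobenius term zero at `x̃`) and the second-order condition at a maximum of `|u|²` (`u(·,t) ∈ C^∞` from the
class). [cite: Iotti2011NSLinfty, proof of Thm 3.1 p.4 d5–d10] -/
theorem step8_holds : Step_8 := by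
  intro ν _hν u₀ f _hu₀ _hf T _hT u p hsol t ht x hx hDu
  have hu : ContDiff ℝ ∞ (u t) := hsol.isClassical.contDiff_velocity ⟨ht.1.le, ht.2⟩
  have hu2 : ContDiff ℝ 2 (u t) := contDiff_infty.mp hu 2
  have hmax : ∀ y, ‖u t y‖ ^ 2 ≤ ‖u t x‖ ^ 2 := fun y =>
    pow_le_pow_left₀ (norm_nonneg _) (hx y) 2
  -- `Δ|u|²(x̃) = 2 ⟪Δu(x̃), u(x̃)⟫` (the Frobenius term vanishes at `Du(x̃) = 0`)
  have hsq : (fun y => ‖u t y‖ ^ 2) = fun y => ⟪u t y, u t y⟫_ℝ :=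
    funext fun y => (real_inner_self_eq_norm_sq (u t y)).symm
  have hlap : Δ (fun y => ‖u t y‖ ^ 2) x = 2 * ⟪u t x, Δ (u t) x⟫_ℝ := by
    rw [hsq, laplacian_inner_self_eq hu2 x, hDu, frobeniusNormSq_zero, mul_zero, add_zero,
      real_inner_comm]
  have hnonpos : ⟪u t x, Δ (u t) x⟫_ℝ ≤ 0 := inner_laplacian_nonpos_of_isMax hu hmax
  refine ⟨?_, ?_⟩
  · rw [hlap]; ring
  · rw [hlap]; linarith

end Literature.Claims.NS.Iotti2011

end
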